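import Literature.Computability.Complexity.TM2Circuits
import Literature.Computability.QuantumComplexity.RevGadgets
import HarnessLib

/-!
# Uniform reversible simulation of `FinTM2` deciders: the circuits (trunk CryptoQuantFine)

The circuit side of the reversible core of `P ⊆ EQP ⊆ BQP` (Bernstein–Vazirani 1997, §8.2,
Thm. 8.2: "a polynomial-time deterministic algorithm … a reversible machine producing
`x; M(x)` … an EQP machine accepting `L`"; circuit form: Arora–Barak 2009, §10.3.7, Lemma 10.10
with Thm. 6.6 — the tableau circuit of a polynomial-time machine (Sipser 2012, Thm. 9.30) with
every Boolean gate replaced by a `NOT`/`CNOT`/Toffoli gate writing into a *fresh* wire, no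
uncomputation being needed since any basis state with the correct answer wire is accepted with
certainty). For a bundled Mathlib machine `M : Turing.TM2ComputableAux Bool Bool` and an
exponent `e` (time bound `T(n) = (n+2)^e`) this file constructs an **explicit, arithmetically
regular** reversible program `RevSim.allOps e M n : List (ClOp ℕ)` (`RevGadgets.ClOp`, wires
indexed by natural numbers given by closed affine formulas — this regularity is what the
uniformity machine of the sequel file prints) and proves that it decides what `M` decides:

* **Views.** `RevSim.View tm d = Ctrl × (Fin d → Cell)`: the control `(label, state)` and the
  top `d` cells of every stack (cells coded in the finite reachable alphabets
  `FinTM2Sim.StackSym` of `TM2Circuits.lean`). By the window lemma of `TM2Window.lean`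
  (`TM2Sim.getElem?_stepTotal_stk`, `TM2Sim.stepTotal_window`) one machine step is: new control
  `= newCtrl (view c)`, new cell `j` of stack `k` `=` cell `j` of the new window
  `newWin (view c) k` if `j < |newWin|`, else old cell `j - |newWin| + d` (`cellVal_stepTotal`,
  `d = depth + 1`).
* **Layout** (`ctrlW`, `cellW`, `ancW`, `deltaW`, `ansW`): inputs `0 … n-1`; for every
  `t ≤ T(n)` a *layer* (one-hot control block of `nC` wires, then `S + d` cells of `CW` wires
  each, cell position `(k, a)`, `a : Option (StackSym k)`, numbered by `eKA`; capacity
  `S = n + d·T + 2d`, the last `d` cells are constant-empty *phantom* cells), followed for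
  `t < T` by a *region* of `nV · rr` ancillas (one Toffoli chain of length `rr = d · #stacks` per
  view `v`, its last ancilla being the *decision wire* `deltaW t v`); then the answer wire.
  Layer `t` starts at `LB t = n + t · PP`; all positions are `n + t · PP + offset`
  (`inPeriod_inj`, `cellW_inj`, …).
* **Gadgets** (`inputOps`, `stepOps = chains ++ restOps`, `outputOps`): the input layer writes
  the one-hot code of the initial configuration; step `t` first computes every decision wire
  `deltaW t v = [view c_t = v]` by a conjunction chain (`RevGadgets.clChain`) over the control
  wire and the `d · #stacks` top-cell wires of `v`, then the new control (`CNOT`s from decision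
  wires), every new cell (`cellOp`: per view a `CNOT` writing a constant of the new window, or a
  Toffoli copying old cell `j + d - |newWin v k|`), and the phantom cells; the output gadget
  copies `[cell 0 of the output stack = code of true]` to the answer wire and swaps it onto
  wire `0`.
* **Semantics** (`Inv`, `inv_input`, `inv_step`, `inv_wAt`, `clEval_allOps_zero`): layer `t`
  holds the one-hot code of the `t`-th configuration of the run and everything beyond is still
  `0`; chains via `clEval_clChain_getLast`, the rest of a step via `clEval_apply_of_disjoint`
  (targets are fresh, controls older) and XOR bookkeeping (`clToggle_*`); stack heights stay
  `≤ S` (`TM2Sim.length_iterate_stepTotal_le`), halting runs are exact iterates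
  (`TM2Sim.iterate_stepTotal_of_outputsWithin`).
* **Export** (`revProg`, `revFamily`, `revEval_revProg_zero`): re-indexed to `Fin (n + ancN)`
  (`finOf`, `clEval_map_finOf_apply`) and made a `RevOp` program (`toRevList`), the program maps
  the padded basis input `x 0^{ancN}` to an assignment with wire `0 = b` whenever `M` outputs
  `[b]` on `x` within `T(n)` steps; `revFamily e M` is its Clifford+T compilation
  (`revCompile`, `revCompile_mulVec_basisState`).

Uniformity of `revFamily` (a `TM2` machine printing `sigmaEncode` of the `n`-th circuit in
polynomial time) is the subject of the sequel; with it, `mem_EQP_of_revFamily`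
(`Cryptography/ClassBQPProofs.lean`) yields `P ⊆ EQP ⊆ BQP`.

## References

* E. Bernstein, U. Vazirani, *Quantum complexity theory*, SIAM J. Comput. 26 (1997)
  1411–1473, §8.2, Thm. 8.2 (`P ⊆ EQP`) and its proof, p. 1451.
* S. Arora, B. Barak, *Computational Complexity: A Modern Approach*, CUP 2009, §10.3.7,
  Lemma 10.10 (Boolean circuits as reversible quantum circuits: `NOT`, `CNOT`, Toffoli on fresh
  wires) and the remark after it (`P ⊆ BQP`); Thm. 6.6 (circuits of a polynomial-time machine).
* M. Sipser, *Introduction to the Theory of Computation*, 3rd ed. 2012, Thm. 9.30 and its proof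
  (the tableau; each cell from the cells above it).
* M. A. Nielsen, I. L. Chuang, *Quantum Computation and Quantum Information*, CUP 2010, §3.2.5
  (reversible computation with Toffoli gates and ancillas), §4.3, Fig. 4.9.

## Design notes

* Wires are natural numbers throughout the construction and its semantic analysis
  (assignments `ℕ → Bool`, zero beyond the circuit); one transport lemma moves to `Fin N`. All
  index maps are explicit sums of products, so that the sequel can print them with counters.
* No uncomputation (garbage is allowed by `mem_EQP_of_basisOutput`); fan-out is free since
  every layer is written into fresh wires.
* The decision wires range over *all* views `v : Ctrl × (Fin d → Cell)` (a large but fixed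
  finite type, numbered by `Finite.equivFin`); the top `2d` cells of a layer need no special
  treatment because `cellOp` branches on `j < |newWin v k|` for each view separately.
-/

namespace Literature.Computability.QuantumComplexity

open Complexity Complexity.FinTM2Sim Turing Function

namespace RevSim

variable (tm : FinTM2)

attribute [local instance] Turing.FinTM2.kFin Turing.FinTM2.ΛFin Turing.FinTM2.σFin
  Turing.FinTM2.Γk₀Fin

/-- The leading `some`-prefix of a list of options. [folklore] -/
def takeSome {α : Type*} : List (Option α) → List α
  | some a :: l => a :: takeSome l
  | _ => []

/-- The `some`-prefix of the empty list. [folklore] -/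
@[simp] theorem takeSome_nil {α : Type*} : takeSome ([] : List (Option α)) = [] := rfl
/-- The `some`-prefix of a list starting with `some a`. [folklore] -/
@[simp] theorem takeSome_cons_some {α : Type*} (a : α) (l : List (Option α)) :
    takeSome (some a :: l) = a :: takeSome l := rfl
/-- The `some`-prefix of a list starting with `none`. [folklore] -/
@[simp] theorem takeSome_cons_none {α : Type*} (l : List (Option α)) :
    takeSome (none :: l) = [] := rfl

/-- The `some`-prefix is no longer than the list. [folklore] -/
theorem length_takeSome_le {α : Type*} : ∀ l : List (Option α), (takeSome l).length ≤ l.length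
  | [] => le_rfl
  | none :: l => by simp
  | some a :: l => by simpa using length_takeSome_le l

/-- The underlying symbol of a reachable symbol (a named projection, so that rewriting does not
need to unfold `StackSym`). [folklore] -/
def symVal (k : tm.K) (s : StackSym tm k) : tm.Γ k := s.1

/-- `symVal` of an explicit reachable symbol. [folklore] -/
@[simp] theorem symVal_mk (k : tm.K) (γ : tm.Γ k) (h : TM2Sim.IsSym tm k γ) :
    symVal tm k ⟨γ, h⟩ = γ := rfl

/-- Views: control and the top `d` cells. [folklore] -/
abbrev View (d : ℕ) : Type := Ctrl tm × (Fin d → Cell tm)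

variable {tm}
variable {d : ℕ}

/-- The window stacks of a view (symbols down to the first empty cell). [folklore] -/
noncomputable def winList (v : View tm d) (k : tm.K) : List (tm.Γ k) :=
  (takeSome ((List.finRange d).map fun m => v.2 m k)).map (symVal tm k)

/-- A window stack has at most `d` symbols. [folklore] -/
theorem length_winList_le (v : View tm d) (k : tm.K) : (winList v k).length ≤ d := by
  unfold winList
  rw [List.length_map]
  refine (length_takeSome_le _).trans ?_
  simp


/-- The truncated configuration described by a view. [folklore] -/
noncomputable def cfgV (v : View tm d) : tm.Cfg := ⟨v.1.1, v.1.2, fun k => winList v k⟩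

variable (d) in
/-- The view of a configuration. [folklore] -/
noncomputable def view (c : tm.Cfg) : View tm d :=
  ((c.l, c.var), fun m k => ((c.stk k)[(m : ℕ)]?).bind (toSym tm k))

/-- On a stack of reachable symbols, the coded top-`d` cells decode to the top-`d` window. [folklore] -/
theorem takeSome_window (k : tm.K) :
    ∀ (d : ℕ) (L : List (tm.Γ k)), (∀ γ ∈ L, TM2Sim.IsSym tm k γ) →
      (takeSome ((List.finRange d).map fun m : Fin d => (L[(m : ℕ)]?).bind (toSym tm k))).map
        (symVal tm k) = L.take d
  | 0, L, _ => by simp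
  | d + 1, [], _ => by
    rw [List.finRange_succ, List.map_cons]
    simp
  | d + 1, γ :: L, hL => by
    rw [List.finRange_succ, List.map_cons, List.map_map]
    have hγ : TM2Sim.IsSym tm k γ := hL γ (by simp)
    have h0 : ((γ :: L)[((0 : Fin (d + 1)) : ℕ)]?).bind (toSym tm k) = some ⟨γ, hγ⟩ := by
      simp [toSym_of_isSym tm hγ]
    rw [h0, takeSome_cons_some, List.map_cons, List.take_succ_cons, symVal_mk]
    have : ((fun m : Fin (d + 1) => ((γ :: L)[(m : ℕ)]?).bind (toSym tm k)) ∘ Fin.succ) =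
        fun m : Fin d => (L[(m : ℕ)]?).bind (toSym tm k) := by
      funext m; simp
    rw [this, takeSome_window k d L fun γ' h => hL γ' (by simp [h])]

/-- The configuration described by the view of a good configuration is its truncation (`TM2Sim.truncate`). [folklore] -/
theorem cfgV_view {c : tm.Cfg} (hc : TM2Sim.Good tm c) :
    cfgV (view d c) = TM2Sim.truncate tm d c := by
  simp only [cfgV, view, TM2Sim.truncate]
  congr 1
  funext k
  exact takeSome_window k d (c.stk k) (hc k)

/-- next configuration data of a view [folklore] -/
noncomputable def next (v : View tm d) : tm.Cfg := TM2Sim.stepTotal tm (cfgV v)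

/-- The control after one step from a view. [folklore] -/
noncomputable def newCtrl (v : View tm d) : Ctrl tm := ((next v).l, (next v).var)

/-- The new top windows after one step from a view. [folklore] -/
noncomputable def newWin (v : View tm d) (k : tm.K) : List (tm.Γ k) := (next v).stk k

/-- The length of the new top window of stack `k` after one step from a view. [folklore] -/
noncomputable def len (v : View tm d) (k : tm.K) : ℕ := (newWin v k).length

/-- New windows are shorter than `2d`. [folklore] -/
theorem len_le (hd : TM2Sim.depth tm < d) (v : View tm d) (k : tm.K) : len v k ≤ 2 * d - 1 := by
  have h1 := TM2Sim.length_stepTotal_le tm (cfgV v) k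
  have h2 := length_winList_le v k
  simp only [len, newWin, next, cfgV] at h1 h2 ⊢
  omega

/-- **Cell form of a step, in terms of the view**: new cell `j` of stack `k` is cell `j` of the
new window if `j` is smaller than its length, and the old cell `j - |W'| + d` otherwise
(`TM2Sim.getElem?_stepTotal_stk`; Sipser 2012, proof of Thm. 9.30, in `TM2` form).
[cite: Sipser2012, Thm. 9.30 (proof)] -/
theorem getElem?_stepTotal (hd : TM2Sim.depth tm ≤ d) {c : tm.Cfg} (hc : TM2Sim.Good tm c)
    (k : tm.K) (j : ℕ) :
    ((TM2Sim.stepTotal tm c).stk k)[j]? =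
      if j < len (view d c) k then (newWin (view d c) k)[j]?
      else (c.stk k)[j - len (view d c) k + d]? := by
  rw [TM2Sim.getElem?_stepTotal_stk tm c d hd k j, ← cfgV_view hc]
  rfl

/-- The new control of a step is a function of the view (`TM2Sim.stepTotal_window`). [folklore] -/
theorem ctrl_stepTotal (hd : TM2Sim.depth tm ≤ d) {c : tm.Cfg} (hc : TM2Sim.Good tm c) :
    ((TM2Sim.stepTotal tm c).l, (TM2Sim.stepTotal tm c).var) = newCtrl (view d c) := by
  rw [TM2Sim.stepTotal_window tm c d hd, newCtrl, next, cfgV_view hc]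
  rfl


/-! ### Layout constants -/

section Consts

variable (tm)

/-- `d = depth + 1`. [folklore] -/
noncomputable def dd : ℕ := TM2Sim.depth tm + 1

/-- `depth < d`. [folklore] -/
theorem depth_lt_dd : TM2Sim.depth tm < dd tm := Nat.lt_succ_self _

/-- `1 ≤ d`. [folklore] -/
theorem one_le_dd : 1 ≤ dd tm := Nat.succ_le_succ (Nat.zero_le _)

/-- number of control codes [folklore] -/
noncomputable def nC : ℕ := Nat.card (Ctrl tm)

/-- numbering of the controls [folklore] -/
noncomputable def eC : Ctrl tm ≃ Fin (nC tm) := Finite.equivFin _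

/-- stack/symbol pairs: the one-hot positions of a cell [folklore] -/
abbrev KA : Type := Σ k : tm.K, Option (StackSym tm k)

/-- cell width [folklore] -/
noncomputable def CW : ℕ := Nat.card (KA tm)

/-- numbering of the one-hot positions of a cell [folklore] -/
noncomputable def eKA : KA tm ≃ Fin (CW tm) := Finite.equivFin _

/-- the views of the machine [folklore] -/
abbrev V : Type := View tm (dd tm)

/-- number of views [folklore] -/
noncomputable def nV : ℕ := Nat.card (V tm)

/-- numbering of the views [folklore] -/
noncomputable def eV : V tm ≃ Fin (nV tm) := Finite.equivFin _

/-- number of stacks [folklore] -/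
noncomputable def nK : ℕ := Fintype.card tm.K

/-- the list of stacks [folklore] -/
noncomputable def kList : List tm.K := Finset.univ.toList

/-- chain length [folklore] -/
noncomputable def rr : ℕ := dd tm * nK tm

/-- There is at least one control code. [folklore] -/
theorem one_le_nC : 1 ≤ nC tm := by
  unfold nC; exact Nat.one_le_iff_ne_zero.2 (Nat.card_pos (α := Ctrl tm)).ne'

/-- Cells have positive width. [folklore] -/
theorem one_le_CW : 1 ≤ CW tm := by
  unfold CW
  haveI : Nonempty (KA tm) := ⟨⟨tm.k₀, none⟩⟩
  exact Nat.one_le_iff_ne_zero.2 (Nat.card_pos (α := KA tm)).ne'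

/-- There is at least one view. [folklore] -/
theorem one_le_nV : 1 ≤ nV tm := by
  unfold nV
  haveI : Nonempty (V tm) := ⟨(default, fun _ _ => none)⟩
  exact Nat.one_le_iff_ne_zero.2 (Nat.card_pos (α := V tm)).ne'

/-- There is at least one stack. [folklore] -/
theorem one_le_nK : 1 ≤ nK tm := Fintype.card_pos_iff.2 ⟨tm.k₀⟩

/-- Chains have positive length. [folklore] -/
theorem one_le_rr : 1 ≤ rr tm := Nat.one_le_iff_ne_zero.2 (Nat.mul_ne_zero
  (Nat.one_le_iff_ne_zero.1 (one_le_dd tm)) (Nat.one_le_iff_ne_zero.1 (one_le_nK tm)))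

/-- The list of stacks has `nK` entries. [folklore] -/
theorem length_kList : (kList tm).length = nK tm := by
  simp [kList, nK]

/-- Every stack is listed. [folklore] -/
theorem mem_kList (k : tm.K) : k ∈ kList tm := by simp [kList]

/-- The list of stacks has no duplicates. [folklore] -/
theorem nodup_kList : (kList tm).Nodup := Finset.nodup_toList _

end Consts

/-! ### Sizes and wire positions -/

section Layout

variable (tm) (e : ℕ)

/-- the time bound `T(n) = (n+2)^e` [folklore] -/
def Tn (n : ℕ) : ℕ := (n + 2) ^ e

/-- the capacity `S(n) = n + d T(n) + 2d` [folklore] -/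
noncomputable def Sn (n : ℕ) : ℕ := n + dd tm * Tn e n + 2 * dd tm

/-- width of a layer block: control block and `S + d` cells [folklore] -/
noncomputable def LW (n : ℕ) : ℕ := nC tm + (Sn tm e n + dd tm) * CW tm

/-- width of a chain region [folklore] -/
noncomputable def RW : ℕ := nV tm * rr tm

/-- the period: one layer and one region [folklore] -/
noncomputable def PP (n : ℕ) : ℕ := LW tm e n + RW tm

/-- base of layer `t` [folklore] -/
noncomputable def LB (n t : ℕ) : ℕ := n + t * PP tm e n

/-- base of region `t` [folklore] -/
noncomputable def RB (n t : ℕ) : ℕ := LB tm e n t + LW tm e n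

/-- control wire [folklore] -/
noncomputable def ctrlW (n t : ℕ) (q : Ctrl tm) : ℕ := LB tm e n t + eC tm q

/-- cell wire [folklore] -/
noncomputable def cellW (n t j : ℕ) (ka : KA tm) : ℕ := LB tm e n t + nC tm + j * CW tm + eKA tm ka

/-- chain ancilla [folklore] -/
noncomputable def ancW (n t : ℕ) (v : V tm) (m : ℕ) : ℕ := RB tm e n t + eV tm v * rr tm + m

/-- the decision wire of a view: the last ancilla of its chain [folklore] -/
noncomputable def deltaW (n t : ℕ) (v : V tm) : ℕ := ancW tm e n t v (rr tm - 1)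

/-- the answer wire [folklore] -/
noncomputable def ansW (n : ℕ) : ℕ := LB tm e n (Tn e n) + LW tm e n

/-- the number of ancillas [folklore] -/
noncomputable def ancN (n : ℕ) : ℕ := Tn e n * PP tm e n + LW tm e n + 1

/-- `1 ≤ T(n)`. [folklore] -/
theorem one_le_Tn (n : ℕ) : 1 ≤ Tn e n := Nat.one_le_pow _ _ (by omega)

/-- The answer wire is the last wire. [folklore] -/
theorem ansW_eq (n : ℕ) : ansW tm e n = n + ancN tm e n - 1 := by
  simp only [ansW, ancN, LB]; omega

/-- The answer wire is a wire. [folklore] -/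
theorem ansW_lt (n : ℕ) : ansW tm e n < n + ancN tm e n := by
  simp only [ansW, ancN, LB]; omega

/-- Regions have positive width. [folklore] -/
theorem one_le_RW : 1 ≤ RW tm := Nat.one_le_iff_ne_zero.2 (Nat.mul_ne_zero
  (Nat.one_le_iff_ne_zero.1 (one_le_nV tm)) (Nat.one_le_iff_ne_zero.1 (one_le_rr tm)))

/-- The next layer starts after the region. [folklore] -/
theorem LB_succ (n t : ℕ) : LB tm e n (t + 1) = RB tm e n t + RW tm := by
  simp only [LB, RB, PP]; ring

/-- Layer `0` starts right after the inputs. [folklore] -/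
theorem LB_zero (n : ℕ) : LB tm e n 0 = n := by simp [LB]

/-- Mixed-radix injectivity. [folklore] -/
theorem mix_inj {c j β j' β' : ℕ} (h : j * c + β = j' * c + β') (hβ : β < c) (hβ' : β' < c) :
    j = j' ∧ β = β' := by
  have hc : 0 < c := by omega
  have h1 : (β + j * c) / c = j := by rw [Nat.add_mul_div_right _ _ hc, Nat.div_eq_of_lt hβ]; simp
  have h2 : (β' + j' * c) / c = j' := by
    rw [Nat.add_mul_div_right _ _ hc, Nat.div_eq_of_lt hβ']; simp
  have hj : j = j' := by rw [← h1, ← h2, add_comm β, add_comm β', h]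
  subst hj
  exact ⟨rfl, by omega⟩

/-- A wire of period `t` at offset `off`. [folklore] -/
noncomputable def inPeriod (n t off : ℕ) : ℕ := n + t * PP tm e n + off

/-- A wire determines its period and its offset. [folklore] -/
theorem inPeriod_inj {n t off t' off' : ℕ} (hoff : off < PP tm e n) (hoff' : off' < PP tm e n)
    (h : inPeriod tm e n t off = inPeriod tm e n t' off') : t = t' ∧ off = off' := by
  simp only [inPeriod, add_assoc] at h
  exact mix_inj (Nat.add_left_cancel h) hoff hoff'

/-- Control wires in period/offset form. [folklore] -/
theorem ctrlW_eq (n t : ℕ) (q : Ctrl tm) : ctrlW tm e n t q = inPeriod tm e n t (eC tm q) := rfl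

/-- Cell wires in period/offset form. [folklore] -/
theorem cellW_eq (n t j : ℕ) (ka : KA tm) :
    cellW tm e n t j ka = inPeriod tm e n t (nC tm + j * CW tm + eKA tm ka) := by
  simp only [cellW, inPeriod, LB]; ring

/-- Ancilla wires in period/offset form. [folklore] -/
theorem ancW_eq (n t : ℕ) (v : V tm) (m : ℕ) :
    ancW tm e n t v m = inPeriod tm e n t (LW tm e n + eV tm v * rr tm + m) := by
  simp only [ancW, inPeriod, RB, LB]; ring

/-- The answer wire in period/offset form. [folklore] -/
theorem ansW_eq_inPeriod (n : ℕ) : ansW tm e n = inPeriod tm e n (Tn e n) (LW tm e n) := rfl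

/-- The control block fits in the layer. [folklore] -/
theorem nC_le_LW (n : ℕ) : nC tm ≤ LW tm e n := Nat.le_add_right _ _

/-- A layer is shorter than a period. [folklore] -/
theorem LW_lt_PP (n : ℕ) : LW tm e n < PP tm e n := by
  have := one_le_RW tm; simp only [PP]; omega

/-- Offsets of control wires. [folklore] -/
theorem ctrl_off_lt (q : Ctrl tm) : (eC tm q : ℕ) < nC tm := (eC tm q).isLt

/-- Offsets of cell wires. [folklore] -/
theorem cell_off_lt {n j : ℕ} (hj : j < Sn tm e n + dd tm) (ka : KA tm) :
    nC tm + j * CW tm + eKA tm ka < LW tm e n := by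
  have h1 : (eKA tm ka : ℕ) < CW tm := (eKA tm ka).isLt
  have h2 : (j + 1) * CW tm ≤ (Sn tm e n + dd tm) * CW tm := Nat.mul_le_mul_right _ hj
  simp only [LW]
  rw [Nat.succ_mul] at h2
  omega

/-- Cell offsets come after the control block. [folklore] -/
theorem nC_le_cell_off (j : ℕ) (ka : KA tm) : nC tm ≤ nC tm + j * CW tm + eKA tm ka := by omega

/-- Offsets of ancilla wires. [folklore] -/
theorem anc_off_lt {n m : ℕ} (v : V tm) (hm : m < rr tm) :
    LW tm e n + eV tm v * rr tm + m < PP tm e n := by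
  have h1 : (eV tm v : ℕ) < nV tm := (eV tm v).isLt
  have h2 : ((eV tm v : ℕ) + 1) * rr tm ≤ nV tm * rr tm := Nat.mul_le_mul_right _ h1
  simp only [PP, RW]
  rw [Nat.succ_mul] at h2
  omega

/-- Ancilla offsets come after the layer. [folklore] -/
theorem LW_le_anc_off (n : ℕ) (v : V tm) (m : ℕ) : LW tm e n ≤ LW tm e n + eV tm v * rr tm + m := by
  omega

/-- Injectivity of cell wires within a layer. [folklore] -/
theorem cellW_inj {n t j j' : ℕ} {ka ka' : KA tm}
    (h : cellW tm e n t j ka = cellW tm e n t j' ka') : j = j' ∧ ka = ka' := by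
  simp only [cellW, add_assoc] at h
  have h' := Nat.add_left_cancel (Nat.add_left_cancel h)
  obtain ⟨hj, hβ⟩ := mix_inj h' (eKA tm ka).isLt (eKA tm ka').isLt
  exact ⟨hj, (eKA tm).injective (Fin.ext hβ)⟩

/-- Injectivity of control wires within a layer. [folklore] -/
theorem ctrlW_inj {n t : ℕ} {q q' : Ctrl tm} (h : ctrlW tm e n t q = ctrlW tm e n t q') : q = q' :=
  (eC tm).injective (Fin.ext (Nat.add_left_cancel h))

/-- Injectivity of ancilla wires within a region. [folklore] -/
theorem ancW_inj {n t m m' : ℕ} {v v' : V tm} (hm : m < rr tm) (hm' : m' < rr tm)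
    (h : ancW tm e n t v m = ancW tm e n t v' m') : v = v' ∧ m = m' := by
  simp only [ancW, add_assoc] at h
  have h' := Nat.add_left_cancel h
  obtain ⟨hv, hmm⟩ := mix_inj h' hm hm'
  exact ⟨(eV tm).injective (Fin.ext hv), hmm⟩

end Layout


/-! ### The gadgets -/

section Ops

variable (tm) (e : ℕ)

/-- the list of all views [folklore] -/
noncomputable def vList : List (V tm) := (List.finRange (nV tm)).map (eV tm).symm

/-- the list of all one-hot positions of a cell [folklore] -/
noncomputable def kaList : List (KA tm) := (List.finRange (CW tm)).map (eKA tm).symm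

/-- Every view is listed. [folklore] -/
theorem mem_vList (v : V tm) : v ∈ vList tm := by
  simp only [vList, List.mem_map, List.mem_finRange, true_and]
  exact ⟨eV tm v, by simp⟩

/-- The list of views has no duplicates. [folklore] -/
theorem nodup_vList : (vList tm).Nodup :=
  (List.nodup_finRange _).map (eV tm).symm.injective

/-- Every one-hot position is listed. [folklore] -/
theorem mem_kaList (ka : KA tm) : ka ∈ kaList tm := by
  simp only [kaList, List.mem_map, List.mem_finRange, true_and]
  exact ⟨eKA tm ka, by simp⟩

/-- The list of one-hot positions has no duplicates. [folklore] -/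
theorem nodup_kaList : (kaList tm).Nodup :=
  (List.nodup_finRange _).map (eKA tm).symm.injective

/-- literals of the chain of a view: the top `d` cells [folklore] -/
noncomputable def lits (n t : ℕ) (v : V tm) : List ℕ :=
  (List.finRange (dd tm)).flatMap fun m : Fin (dd tm) =>
    (kList tm).map fun k => cellW tm e n t (m : ℕ) ⟨k, v.2 m k⟩

/-- ancillas of the chain of a view [folklore] -/
noncomputable def ancs (n t : ℕ) (v : V tm) : List ℕ :=
  (List.range (rr tm)).map fun m => ancW tm e n t v m

/-- the chain of a view [folklore] -/
noncomputable def chainOps (n t : ℕ) (v : V tm) : List (ClOp ℕ) :=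
  clChain (ctrlW tm e n t v.1) (lits tm e n t v) (ancs tm e n t v)

/-- the new control, from the decision wires [folklore] -/
noncomputable def ctrlOps (n t : ℕ) (v : V tm) : List (ClOp ℕ) :=
  [ClOp.cnot (deltaW tm e n t v) (ctrlW tm e n (t + 1) (newCtrl v))]

open Classical in
/-- one cell position of the new layer, contribution of one view [folklore] -/
noncomputable def cellOp (n t j : ℕ) (ka : KA tm) (v : V tm) : List (ClOp ℕ) :=
  if h : j < (newWin v ka.1).length then
    (if toSym tm ka.1 ((newWin v ka.1)[j]) = ka.2 then
      [ClOp.cnot (deltaW tm e n t v) (cellW tm e n (t + 1) j ka)] else [])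
  else [ClOp.toffoli (deltaW tm e n t v) (cellW tm e n t (j + dd tm - (newWin v ka.1).length) ka)
    (cellW tm e n (t + 1) j ka)]

/-- all gadgets of one cell of the new layer [folklore] -/
noncomputable def cellOps (n t j : ℕ) : List (ClOp ℕ) :=
  (kaList tm).flatMap fun ka => (vList tm).flatMap fun v => cellOp tm e n t j ka v

/-- a phantom (always empty) cell of the new layer [folklore] -/
noncomputable def phantomOps (n t j : ℕ) : List (ClOp ℕ) :=
  (kList tm).map fun k => ClOp.not (cellW tm e n (t + 1) j ⟨k, none⟩)

/-- the non-chain part of a step [folklore] -/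
noncomputable def restOps (n t : ℕ) : List (ClOp ℕ) :=
  (vList tm).flatMap (ctrlOps tm e n t) ++
    ((List.range (Sn tm e n)).flatMap (cellOps tm e n t) ++
      (List.range' (Sn tm e n) (dd tm)).flatMap (phantomOps tm e n t))

/-- one step [folklore] -/
noncomputable def stepOps (n t : ℕ) : List (ClOp ℕ) :=
  (vList tm).flatMap (chainOps tm e n t) ++ restOps tm e n t

variable (M : TM2ComputableAux Bool Bool)

/-- the reachable symbol of an input bit [folklore] -/
noncomputable def symIn (b : Bool) : StackSym M.tm M.tm.k₀ := ⟨M.inputAlphabet.symm b, Or.inr rfl⟩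

/-- writing input bit `i` into cell `i` of layer `0` [folklore] -/
noncomputable def inCell (n i : ℕ) : List (ClOp ℕ) :=
  [ClOp.cnot i (cellW M.tm e n 0 i ⟨M.tm.k₀, some (symIn M true)⟩),
    ClOp.not (cellW M.tm e n 0 i ⟨M.tm.k₀, some (symIn M false)⟩),
    ClOp.cnot i (cellW M.tm e n 0 i ⟨M.tm.k₀, some (symIn M false)⟩)] ++
  ((kList M.tm).filter fun k => k ≠ M.tm.k₀).map fun k => ClOp.not (cellW M.tm e n 0 i ⟨k, none⟩)

/-- an empty cell of layer `0` [folklore] -/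
noncomputable def emptyCell (n i : ℕ) : List (ClOp ℕ) :=
  (kList tm).map fun k => ClOp.not (cellW tm e n 0 i ⟨k, none⟩)

/-- the input layer [folklore] -/
noncomputable def inputOps (n : ℕ) : List (ClOp ℕ) :=
  [ClOp.not (ctrlW M.tm e n 0 (some M.tm.main, M.tm.initialState))] ++
    ((List.range n).flatMap (inCell e M n) ++
      (List.range' n (Sn M.tm e n + dd M.tm - n)).flatMap (emptyCell M.tm e n))

/-- the one-hot position read out at the end: the code of `true` on the output stack [folklore] -/
noncomputable def outKA : KA M.tm :=
  ⟨M.tm.k₁, toSym M.tm M.tm.k₁ (M.outputAlphabet.symm true)⟩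

/-- read-out and final swap onto wire `0` [folklore] -/
noncomputable def outputOps (n : ℕ) : List (ClOp ℕ) :=
  [ClOp.cnot (cellW M.tm e n (Tn e n) 0 (outKA M)) (ansW M.tm e n),
    ClOp.cnot (ansW M.tm e n) 0, ClOp.cnot 0 (ansW M.tm e n), ClOp.cnot (ansW M.tm e n) 0]

/-- **The whole reversible program** on inputs of length `n`: input layer, `T(n)` simulation
steps, read-out (Arora–Barak 2009, Lemma 10.10 with Thm. 6.6: the tableau circuit of a
polynomial-time machine with every gate replaced by `NOT`/`CNOT`/Toffoli gates on fresh
wires; Bernstein–Vazirani 1997, proof of Thm. 8.2). [cite: AroraBarak2009, §10.3.7 Lemma 10.10] -/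
noncomputable def allOps (n : ℕ) : List (ClOp ℕ) :=
  inputOps e M n ++ ((List.range (Tn e n)).flatMap (stepOps M.tm e n) ++ outputOps e M n)

end Ops


/-! ### Semantics: the invariant and the chains -/

section Semantics

variable {e : ℕ}

/-- XOR over a list of unset terms. [folklore] -/
theorem foldr_xor_map_eq_false {α : Type*} {l : List α} (f : α → Bool) (hf : ∀ a ∈ l, f a = false) :
    (l.map f).foldr Bool.xor false = false := by
  induction l with
  | nil => rfl
  | cons b l ih =>
    rw [List.map_cons, List.foldr_cons, hf b (by simp), ih (fun a ha => hf a (by simp [ha]))]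
    rfl

/-- XOR over a list with at most one possibly-set term. [folklore] -/
theorem foldr_xor_map_of_unique {α : Type*} {l : List α} (hl : l.Nodup) {a₀ : α} (ha₀ : a₀ ∈ l)
    (f : α → Bool) (hf : ∀ a ∈ l, a ≠ a₀ → f a = false) :
    (l.map f).foldr Bool.xor false = f a₀ := by
  induction l with
  | nil => simp at ha₀
  | cons b l ih =>
    rw [List.nodup_cons] at hl
    rw [List.map_cons, List.foldr_cons]
    rcases List.mem_cons.1 ha₀ with rfl | h
    · rw [foldr_xor_map_eq_false f fun a ha => hf a (by simp [ha]) fun e => hl.1 (e ▸ ha),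
        Bool.xor_false]
    · rw [hf b (by simp) (fun e => hl.1 (e ▸ h)), ih hl.2 h (fun a ha hne => hf a (by simp [ha]) hne),
        Bool.false_xor]

/-- `clToggle` of a `flatMap`. [folklore] -/
theorem clToggle_flatMap {α : Type*} (l : List α) (f : α → List (ClOp ℕ)) (w : ℕ → Bool) (i : ℕ) :
    clToggle (l.flatMap f) w i = (l.map fun a => clToggle (f a) w i).foldr Bool.xor false := by
  induction l with
  | nil => rfl
  | cons a l ih => rw [List.flatMap_cons, clToggle_append, ih, List.map_cons, List.foldr_cons]

/-- The (coded) content of cell `j` of stack `k`. [folklore] -/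
noncomputable def cellVal (c : tm.Cfg) (j : ℕ) (k : tm.K) : Option (StackSym tm k) :=
  ((c.stk k)[j]?).bind (toSym tm k)

/-- The cells of a view are the coded cells of the configuration. [folklore] -/
theorem view_snd_apply {d : ℕ} (c : tm.Cfg) (m : Fin d) (k : tm.K) :
    (view d c).2 m k = cellVal c m k := rfl

open Classical in
/-- The invariant: layer `t` holds the one-hot code of `c`, and everything from region `t`
on is still fresh. [folklore] -/
structure Inv (e n t : ℕ) (c : tm.Cfg) (w : ℕ → Bool) : Prop where
  ctrl : ∀ q, w (ctrlW tm e n t q) = decide ((c.l, c.var) = q)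
  cell : ∀ j < Sn tm e n + dd tm, ∀ ka : KA tm,
    w (cellW tm e n t j ka) = decide (cellVal c j ka.1 = ka.2)
  fresh : ∀ i, RB tm e n t ≤ i → w i = false

/-! #### zone facts -/

/-- Control wires lie before the region. [folklore] -/
theorem ctrlW_lt_RB (n t : ℕ) (q : Ctrl tm) : ctrlW tm e n t q < RB tm e n t := by
  have h1 := ctrl_off_lt tm q
  have h2 := nC_le_LW tm e n
  simp only [ctrlW, RB]; omega

/-- Cell wires lie before the region. [folklore] -/
theorem cellW_lt_RB {n t j : ℕ} (hj : j < Sn tm e n + dd tm) (ka : KA tm) :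
    cellW tm e n t j ka < RB tm e n t := by
  have := cell_off_lt tm e hj ka
  simp only [cellW, RB]; omega

/-- Control wires lie before the cells of their layer. [folklore] -/
theorem ctrlW_lt_cellW (n t : ℕ) (q : Ctrl tm) (j : ℕ) (ka : KA tm) :
    ctrlW tm e n t q < cellW tm e n t j ka := by
  have h1 := ctrl_off_lt tm q
  simp only [ctrlW, cellW]; omega

/-- Ancillas lie in the region. [folklore] -/
theorem RB_le_ancW (n t : ℕ) (v : V tm) (m : ℕ) : RB tm e n t ≤ ancW tm e n t v m := by
  simp only [ancW]; omega

/-- Ancillas lie before the next layer. [folklore] -/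
theorem ancW_lt_LB_succ {n t m : ℕ} (v : V tm) (hm : m < rr tm) :
    ancW tm e n t v m < LB tm e n (t + 1) := by
  have := anc_off_lt tm e (n := n) v hm
  rw [LB_succ]
  simp only [ancW, RB, PP] at this ⊢; omega

/-- Decision wires lie before the next layer. [folklore] -/
theorem deltaW_lt_LB_succ (n t : ℕ) (v : V tm) : deltaW tm e n t v < LB tm e n (t + 1) :=
  ancW_lt_LB_succ v (by have := one_le_rr tm; omega)

/-- Decision wires lie in the region. [folklore] -/
theorem RB_le_deltaW (n t : ℕ) (v : V tm) : RB tm e n t ≤ deltaW tm e n t v := RB_le_ancW n t v _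

/-- The region lies before the next layer. [folklore] -/
theorem RB_le_LB_succ (n t : ℕ) : RB tm e n t ≤ LB tm e n (t + 1) := by
  rw [LB_succ]; omega

/-- Control wires lie in their layer. [folklore] -/
theorem LB_le_ctrlW (n t : ℕ) (q : Ctrl tm) : LB tm e n t ≤ ctrlW tm e n t q := Nat.le_add_right _ _

/-- Cell wires lie in their layer. [folklore] -/
theorem LB_le_cellW (n t j : ℕ) (ka : KA tm) : LB tm e n t ≤ cellW tm e n t j ka := by
  simp only [cellW]; omega

/-- Layers are laid out in order. [folklore] -/
theorem LB_mono (n : ℕ) {t t' : ℕ} (h : t ≤ t') : LB tm e n t ≤ LB tm e n t' := by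
  simp only [LB]; exact Nat.add_le_add_left (Nat.mul_le_mul_right _ h) _

/-! #### the chains -/

/-- A chain has `rr` literals. [folklore] -/
theorem length_lits (n t : ℕ) (v : V tm) : (lits tm e n t v).length = rr tm := by
  simp [lits, List.length_flatMap, length_kList, rr]

/-- A chain has `rr` ancillas. [folklore] -/
theorem length_ancs (n t : ℕ) (v : V tm) : (ancs tm e n t v).length = rr tm := by
  simp [ancs]

/-- Membership in the ancillas of a chain. [folklore] -/
theorem mem_ancs_iff {n t : ℕ} {v : V tm} {i : ℕ} :
    i ∈ ancs tm e n t v ↔ ∃ m < rr tm, i = ancW tm e n t v m := by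
  simp [ancs, eq_comm]

/-- The ancillas of a chain are distinct. [folklore] -/
theorem nodup_ancs (n t : ℕ) (v : V tm) : (ancs tm e n t v).Nodup := by
  refine (List.nodup_range).map fun m m' h => ?_
  simpa [ancW] using h

/-- A chain has an ancilla. [folklore] -/
theorem ancs_ne_nil (n t : ℕ) (v : V tm) : ancs tm e n t v ≠ [] := by
  rw [← List.length_pos_iff_ne_nil, length_ancs]; exact one_le_rr tm

/-- The last ancilla of a chain is the decision wire. [folklore] -/
theorem getLast_ancs (n t : ℕ) (v : V tm) :
    (ancs tm e n t v).getLast (ancs_ne_nil n t v) = deltaW tm e n t v := by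
  rw [List.getLast_eq_getElem]
  simp [ancs, deltaW]

/-- Membership in the literals of a chain. [folklore] -/
theorem mem_lits_iff {n t : ℕ} {v : V tm} {i : ℕ} :
    i ∈ lits tm e n t v ↔ ∃ (m : Fin (dd tm)) (k : tm.K), i = cellW tm e n t m ⟨k, v.2 m k⟩ := by
  simp [lits, mem_kList, eq_comm]

/-- Literals lie before the region. [folklore] -/
theorem lits_lt_RB {n t : ℕ} {v : V tm} {i : ℕ} (hi : i ∈ lits tm e n t v) : i < RB tm e n t := by
  obtain ⟨m, k, rfl⟩ := mem_lits_iff.1 hi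
  exact cellW_lt_RB (by have := m.isLt; omega) _

open Classical in
/-- Under the invariant, all literals of the chain of `v` are set iff the top cells agree with `v`. [folklore] -/
theorem all_lits (n t : ℕ) (v : V tm) (c : tm.Cfg) (w : ℕ → Bool) (hw : Inv e n t c w) :
    (lits tm e n t v).all w = decide (∀ (m : Fin (dd tm)) (k : tm.K), cellVal c m k = v.2 m k) := by
  have key : ∀ (m : Fin (dd tm)) (k : tm.K),
      w (cellW tm e n t m ⟨k, v.2 m k⟩) = decide (cellVal c m k = v.2 m k) := fun m k =>
    hw.cell m (by have := m.isLt; omega) ⟨k, v.2 m k⟩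
  by_cases h : ∀ (m : Fin (dd tm)) (k : tm.K), cellVal c m k = v.2 m k
  · rw [decide_eq_true h, List.all_eq_true]
    intro i hi
    obtain ⟨m, k, rfl⟩ := mem_lits_iff.1 hi
    rw [key, decide_eq_true (h m k)]
  · rw [decide_eq_false h, List.all_eq_false]
    push Not at h
    obtain ⟨m, k, hmk⟩ := h
    exact ⟨_, mem_lits_iff.2 ⟨m, k, rfl⟩, by rw [key]; simpa using hmk⟩

/-- A configuration has view `v` iff its control and its top cells are those of `v`. [folklore] -/
theorem view_eq_iff {d : ℕ} (c : tm.Cfg) (v : View tm d) :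
    view d c = v ↔ (c.l, c.var) = v.1 ∧ ∀ (m : Fin d) (k : tm.K), cellVal c m k = v.2 m k := by
  constructor
  · rintro rfl; exact ⟨rfl, fun m k => rfl⟩
  · rintro ⟨h1, h2⟩
    exact Prod.ext h1 (funext fun m => funext fun k => h2 m k)

open Classical in
/-- One chain: the decision wire of `v` receives `[view c = v]`, nothing outside the chain's
ancillas changes. [folklore] -/
theorem chain_one (n t : ℕ) (v : V tm) (c : tm.Cfg) (w : ℕ → Bool) (hw : Inv e n t c w)
    (w' : ℕ → Bool) (hlay : ∀ i < RB tm e n t, w' i = w i)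
    (hfresh : ∀ m < rr tm, w' (ancW tm e n t v m) = false) :
    clEval (chainOps tm e n t v) w' (deltaW tm e n t v) = decide (view (dd tm) c = v) ∧
      ∀ i, (∀ m < rr tm, i ≠ ancW tm e n t v m) → clEval (chainOps tm e n t v) w' i = w' i := by
  constructor
  · rw [chainOps, ← getLast_ancs n t v, clEval_clChain_getLast _ _ _ _
      ((length_lits n t v).trans (length_ancs n t v).symm) (ancs_ne_nil n t v) (nodup_ancs n t v)
      (fun l hl hl' => ?_) (fun a ha => ?_)]
    · rw [hlay _ (ctrlW_lt_RB n t v.1), hw.ctrl v.1]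
      have hall : (lits tm e n t v).all w' = (lits tm e n t v).all w :=
        List.all_congr_of_forall_mem fun i hi => hlay i (lits_lt_RB hi)
      rw [hall, all_lits n t v c w hw, ← Bool.decide_and]
      by_cases hv : view (dd tm) c = v
      · rw [decide_eq_true hv, decide_eq_true ((view_eq_iff c v).1 hv)]
      · rw [decide_eq_false hv, decide_eq_false (fun h => hv ((view_eq_iff c v).2 h))]
    · obtain ⟨m, hm, rfl⟩ := mem_ancs_iff.1 hl'
      exact absurd (RB_le_ancW (e := e) n t v m) (not_le.2 (lits_lt_RB hl))
    · obtain ⟨m, hm, rfl⟩ := mem_ancs_iff.1 ha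
      exact hfresh m hm
  · intro i hi
    exact clEval_clChain_of_not_mem _ _ _ _ fun hmem => by
      obtain ⟨m, hm, rfl⟩ := mem_ancs_iff.1 hmem
      exact hi m hm rfl

open Classical in
/-- All chains of a duplicate-free list of views. [folklore] -/
theorem chains_list (n t : ℕ) (c : tm.Cfg) (w : ℕ → Bool) (hw : Inv e n t c w) :
    ∀ (L : List (V tm)), L.Nodup → ∀ (w' : ℕ → Bool), (∀ i < RB tm e n t, w' i = w i) →
      (∀ v ∈ L, ∀ m < rr tm, w' (ancW tm e n t v m) = false) →
      (∀ v ∈ L, clEval (L.flatMap (chainOps tm e n t)) w' (deltaW tm e n t v) =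
          decide (view (dd tm) c = v)) ∧
      ∀ i, (∀ v ∈ L, ∀ m < rr tm, i ≠ ancW tm e n t v m) →
        clEval (L.flatMap (chainOps tm e n t)) w' i = w' i
  | [], _, w', _, _ => by simp
  | v :: L, hL, w', hlay, hfresh => by
    rw [List.nodup_cons] at hL
    obtain ⟨h1, h2⟩ := chain_one n t v c w hw w' hlay (hfresh v (by simp))
    have hvL : ∀ v' ∈ L, ∀ m < rr tm, ∀ m', m' < rr tm →
        ancW tm e n t v' m ≠ ancW tm e n t v m' := by
      intro v' hv' m hm m' hm' heq
      exact hL.1 ((ancW_inj tm e hm hm' heq).1 ▸ hv')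
    have hlay' : ∀ i < RB tm e n t, clEval (chainOps tm e n t v) w' i = w i := fun i hi => by
      rw [h2 i fun m hm heq => absurd (RB_le_ancW (e := e) n t v m) (by rw [← heq]; exact not_le.2 hi),
        hlay i hi]
    have hfresh' : ∀ v' ∈ L, ∀ m < rr tm,
        clEval (chainOps tm e n t v) w' (ancW tm e n t v' m) = false := fun v' hv' m hm => by
      rw [h2 _ fun m' hm' heq => hvL v' hv' m hm m' hm' heq, hfresh v' (by simp [hv']) m hm]
    obtain ⟨ih1, ih2⟩ := chains_list n t c w hw L hL.2 _ hlay' hfresh'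
    refine ⟨fun v' hv' => ?_, fun i hi => ?_⟩
    · rw [List.flatMap_cons, clEval_append]
      rcases List.mem_cons.1 hv' with rfl | hv'
      · rw [ih2 (deltaW tm e n t v') fun v'' hv'' m hm heq => hvL v'' hv'' m hm (rr tm - 1)
          (by have := one_le_rr tm; omega) (heq ▸ rfl), h1]
      · exact ih1 v' hv'
    · rw [List.flatMap_cons, clEval_append, ih2 i fun v' hv' m hm => hi v' (by simp [hv']) m hm,
        h2 i fun m hm => hi v (by simp) m hm]

end Semantics


/-! ### Semantics: the rest of a step -/

section Step

variable {e : ℕ}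

/-- Cells below the bottom of a stack are empty. [folklore] -/
theorem cellVal_of_length_le {c : tm.Cfg} {j : ℕ} {k : tm.K} (h : (c.stk k).length ≤ j) :
    cellVal c j k = none := by
  simp [cellVal, List.getElem?_eq_none h]

/-- The cells after a step, in terms of the view (`TM2Sim.getElem?_stepTotal_stk`). [folklore] -/
theorem cellVal_stepTotal {c : tm.Cfg} (hc : TM2Sim.Good tm c) (j : ℕ) (k : tm.K) :
    cellVal (TM2Sim.stepTotal tm c) j k =
      if h : j < (newWin (view (dd tm) c) k).length then
        toSym tm k ((newWin (view (dd tm) c) k)[j])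
      else cellVal c (j + dd tm - (newWin (view (dd tm) c) k).length) k := by
  unfold cellVal
  rw [getElem?_stepTotal (le_of_lt (depth_lt_dd tm)) hc k j]
  simp only [len]
  split_ifs with h
  · rw [List.getElem?_eq_getElem h]; rfl
  · congr 2; omega

/-- membership in the parts of `restOps` [folklore] -/
theorem mem_ctrlOps_flatMap {n t : ℕ} {op : ClOp ℕ} (h : op ∈ (vList tm).flatMap (ctrlOps tm e n t)) :
    ∃ v, op = ClOp.cnot (deltaW tm e n t v) (ctrlW tm e n (t + 1) (newCtrl v)) := by
  simp only [List.mem_flatMap, ctrlOps, List.mem_singleton] at h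
  obtain ⟨v, -, rfl⟩ := h
  exact ⟨v, rfl⟩

/-- The operations of `cellOp`. [folklore] -/
theorem mem_cellOp {n t j : ℕ} {ka : KA tm} {v : V tm} {op : ClOp ℕ}
    (h : op ∈ cellOp tm e n t j ka v) :
    op = ClOp.cnot (deltaW tm e n t v) (cellW tm e n (t + 1) j ka) ∨
      op = ClOp.toffoli (deltaW tm e n t v)
        (cellW tm e n t (j + dd tm - (newWin v ka.1).length) ka) (cellW tm e n (t + 1) j ka) := by
  unfold cellOp at h
  split_ifs at h with h1 h2
  · left; simpa using h
  · simp at h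
  · right; simpa using h

/-- The operations of the cell part of a step. [folklore] -/
theorem mem_cellOps_flatMap {n t : ℕ} {op : ClOp ℕ}
    (h : op ∈ (List.range (Sn tm e n)).flatMap (cellOps tm e n t)) :
    ∃ j < Sn tm e n, ∃ (ka : KA tm) (v : V tm), op ∈ cellOp tm e n t j ka v := by
  simp only [List.mem_flatMap, List.mem_range, cellOps] at h
  obtain ⟨j, hj, ka, -, v, -, h⟩ := h
  exact ⟨j, hj, ka, v, h⟩

/-- The operations of the phantom part of a step. [folklore] -/
theorem mem_phantomOps_flatMap {n t : ℕ} {op : ClOp ℕ}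
    (h : op ∈ (List.range' (Sn tm e n) (dd tm)).flatMap (phantomOps tm e n t)) :
    ∃ j, Sn tm e n ≤ j ∧ j < Sn tm e n + dd tm ∧ ∃ k, op = ClOp.not (cellW tm e n (t + 1) j ⟨k, none⟩) := by
  simp only [List.mem_flatMap, List.mem_range'_1, phantomOps, List.mem_map] at h
  obtain ⟨j, ⟨hj1, hj2⟩, k, -, rfl⟩ := h
  exact ⟨j, hj1, hj2, k, rfl⟩

/-- Source cells of copies are cells of the old layer. [folklore] -/
theorem sub_len_lt {n j : ℕ} (hj : j < Sn tm e n) (v : V tm) (k : tm.K) :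
    j + dd tm - (newWin v k).length < Sn tm e n + dd tm := by omega

/-- Every operation of the rest of a step writes into layer `t + 1` and reads below it. [folklore] -/
theorem restOps_zones {n t : ℕ} {op : ClOp ℕ} (h : op ∈ restOps tm e n t) :
    LB tm e n (t + 1) ≤ op.target ∧ op.target < RB tm e n (t + 1) ∧
      ∀ i ∈ op.controls, i < LB tm e n (t + 1) := by
  simp only [restOps, List.mem_append] at h
  rcases h with h | h | h
  · obtain ⟨v, rfl⟩ := mem_ctrlOps_flatMap h
    exact ⟨LB_le_ctrlW n _ _, ctrlW_lt_RB n _ _, by simp [ClOp.controls, deltaW_lt_LB_succ]⟩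
  · obtain ⟨j, hj, ka, v, h⟩ := mem_cellOps_flatMap h
    have hj' : j < Sn tm e n + dd tm := by omega
    rcases mem_cellOp h with rfl | rfl
    · exact ⟨LB_le_cellW n _ _ _, cellW_lt_RB hj' _, by simp [ClOp.controls, deltaW_lt_LB_succ]⟩
    · refine ⟨LB_le_cellW n _ _ _, cellW_lt_RB hj' _, ?_⟩
      simp only [ClOp.controls, List.mem_cons, List.not_mem_nil, or_false]
      rintro i (rfl | rfl)
      · exact deltaW_lt_LB_succ n t v
      · exact (cellW_lt_RB (sub_len_lt hj v ka.1) ka).trans_le (RB_le_LB_succ n t)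
  · obtain ⟨j, hj1, hj2, k, rfl⟩ := mem_phantomOps_flatMap h
    exact ⟨LB_le_cellW n _ _ _, cellW_lt_RB hj2 _, by simp [ClOp.controls]⟩

/-- No target of the rest of a step is a control of it. [folklore] -/
theorem restOps_disjoint (n t : ℕ) :
    ∀ op ∈ restOps tm e n t, ∀ op' ∈ restOps tm e n t, op'.target ∉ op.controls := by
  intro op hop op' hop' hmem
  have h1 := (restOps_zones hop).2.2 _ hmem
  have h2 := (restOps_zones hop').1
  omega

/-! #### toggles of the rest -/

open Classical in
/-- The assignment after the chains. [folklore] -/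
structure Mid (e n t : ℕ) (c : tm.Cfg) (w' : ℕ → Bool) : Prop where
  ctrl : ∀ q, w' (ctrlW tm e n t q) = decide ((c.l, c.var) = q)
  cell : ∀ j < Sn tm e n + dd tm, ∀ ka : KA tm,
    w' (cellW tm e n t j ka) = decide (cellVal c j ka.1 = ka.2)
  delta : ∀ v, w' (deltaW tm e n t v) = decide (view (dd tm) c = v)
  fresh : ∀ i, LB tm e n (t + 1) ≤ i → w' i = false

open Classical in
/-- The chains compute all decision wires and change nothing else. [folklore] -/
theorem mid_of_inv (n t : ℕ) (c : tm.Cfg) (w : ℕ → Bool) (hw : Inv e n t c w) :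
    Mid e n t c (clEval ((vList tm).flatMap (chainOps tm e n t)) w) := by
  obtain ⟨h1, h2⟩ := chains_list n t c w hw (vList tm) (nodup_vList tm) w (fun _ _ => rfl)
    (fun v _ m _ => hw.fresh _ (RB_le_ancW n t v m))
  have hoff : ∀ i, (i < RB tm e n t ∨ LB tm e n (t + 1) ≤ i) →
      clEval ((vList tm).flatMap (chainOps tm e n t)) w i = w i := fun i hi =>
    h2 i fun v _ m hm heq => by
      subst heq
      rcases hi with hi | hi
      · exact absurd (RB_le_ancW (e := e) n t v m) (not_le.2 hi)
      · exact absurd (ancW_lt_LB_succ (e := e) (n := n) (t := t) v hm) (not_lt.2 hi)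
  refine ⟨fun q => ?_, fun j hj ka => ?_, fun v => h1 v (mem_vList tm v), fun i hi => ?_⟩
  · rw [hoff _ (Or.inl (ctrlW_lt_RB n t q)), hw.ctrl]
  · rw [hoff _ (Or.inl (cellW_lt_RB hj ka)), hw.cell j hj ka]
  · rw [hoff _ (Or.inr hi), hw.fresh i ((RB_le_LB_succ n t).trans hi)]

open Classical in
/-- The control part of a step toggles the code of the new control. [folklore] -/
theorem clToggle_ctrl_part (n t : ℕ) (c : tm.Cfg) (w' : ℕ → Bool) (hw : Mid e n t c w') (q : Ctrl tm) :
    clToggle ((vList tm).flatMap (ctrlOps tm e n t)) w' (ctrlW tm e n (t + 1) q) =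
      decide (newCtrl (view (dd tm) c) = q) := by
  rw [clToggle_flatMap, foldr_xor_map_of_unique (nodup_vList tm) (mem_vList tm (view (dd tm) c))]
  · simp only [ctrlOps, clToggle_cons, clToggle_nil, Bool.xor_false, ClOp.target, ClOp.guard,
      hw.delta, decide_true, Bool.and_true]
    by_cases h : newCtrl (view (dd tm) c) = q
    · subst h; simp
    · have h' : ctrlW tm e n (t + 1) (newCtrl (view (dd tm) c)) ≠ ctrlW tm e n (t + 1) q :=
        fun h' => h (ctrlW_inj tm e h')
      simp [h, h']
  · intro v _ hv
    simp [ctrlOps, ClOp.target, ClOp.guard, hw.delta, Ne.symm hv]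

/-- The control part of a step does not touch cells. [folklore] -/
theorem clToggle_ctrl_part_cell (n t : ℕ) (w' : ℕ → Bool) (j : ℕ) (ka : KA tm) :
    clToggle ((vList tm).flatMap (ctrlOps tm e n t)) w' (cellW tm e n (t + 1) j ka) = false :=
  clToggle_flatMap_eq_false _ _ _ _ fun v _ op hop => by
    simp only [ctrlOps, List.mem_singleton] at hop
    subst hop
    exact (ctrlW_lt_cellW n (t + 1) _ j ka).ne

/-- The cell part of a step does not touch controls. [folklore] -/
theorem clToggle_cells_part_ctrl (n t : ℕ) (w' : ℕ → Bool) (q : Ctrl tm) :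
    clToggle ((List.range (Sn tm e n)).flatMap (cellOps tm e n t)) w' (ctrlW tm e n (t + 1) q) =
      false :=
  clToggle_eq_false_of_forall_ne _ _ fun op hop => by
    obtain ⟨j, hj, ka, v, h⟩ := mem_cellOps_flatMap hop
    rcases mem_cellOp h with rfl | rfl <;> exact (ctrlW_lt_cellW n (t + 1) q j ka).ne'

/-- The phantom part of a step does not touch controls. [folklore] -/
theorem clToggle_phantom_part_ctrl (n t : ℕ) (w' : ℕ → Bool) (q : Ctrl tm) :
    clToggle ((List.range' (Sn tm e n) (dd tm)).flatMap (phantomOps tm e n t)) w'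
      (ctrlW tm e n (t + 1) q) = false :=
  clToggle_eq_false_of_forall_ne _ _ fun op hop => by
    obtain ⟨j, hj1, hj2, k, rfl⟩ := mem_phantomOps_flatMap hop
    exact (ctrlW_lt_cellW n (t + 1) q j _).ne'

/-- The phantom part of a step does not touch real cells. [folklore] -/
theorem clToggle_phantom_part_cell {n t j : ℕ} (hj : j < Sn tm e n) (w' : ℕ → Bool) (ka : KA tm) :
    clToggle ((List.range' (Sn tm e n) (dd tm)).flatMap (phantomOps tm e n t)) w'
      (cellW tm e n (t + 1) j ka) = false :=
  clToggle_eq_false_of_forall_ne _ _ fun op hop => by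
    obtain ⟨j', hj1, hj2, k, rfl⟩ := mem_phantomOps_flatMap hop
    intro h
    have := (cellW_inj tm e h).1
    omega

/-- The cell part of a step does not touch phantom cells. [folklore] -/
theorem clToggle_cells_part_phantom {n t j : ℕ} (hj : Sn tm e n ≤ j) (w' : ℕ → Bool) (ka : KA tm) :
    clToggle ((List.range (Sn tm e n)).flatMap (cellOps tm e n t)) w' (cellW tm e n (t + 1) j ka) =
      false :=
  clToggle_eq_false_of_forall_ne _ _ fun op hop => by
    obtain ⟨j', hj', ka', v, h⟩ := mem_cellOps_flatMap hop
    rcases mem_cellOp h with rfl | rfl <;>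
    · intro h'
      have := (cellW_inj tm e h').1
      omega

open Classical in
/-- Gadgets of views other than the actual one toggle nothing. [folklore] -/
theorem clToggle_cellOp_of_ne {n t j : ℕ} {ka : KA tm} {v : V tm} (c : tm.Cfg) (w' : ℕ → Bool)
    (hw : Mid e n t c w') (hv : v ≠ view (dd tm) c) (i : ℕ) :
    clToggle (cellOp tm e n t j ka v) w' i = false := by
  refine clToggle_eq_false_of_guard _ _ _ fun op hop => ?_
  rcases mem_cellOp hop with rfl | rfl <;> simp [ClOp.guard, hw.delta, Ne.symm hv]

open Classical in
/-- The gadget of the actual view toggles the code of the new cell content. [folklore] -/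
theorem clToggle_cellOp_self {n t j : ℕ} (hj : j < Sn tm e n) (ka : KA tm) (c : tm.Cfg)
    (hc : TM2Sim.Good tm c) (w' : ℕ → Bool) (hw : Mid e n t c w') :
    clToggle (cellOp tm e n t j ka (view (dd tm) c)) w' (cellW tm e n (t + 1) j ka) =
      decide (cellVal (TM2Sim.stepTotal tm c) j ka.1 = ka.2) := by
  rw [cellVal_stepTotal hc]
  unfold cellOp
  by_cases h : j < (newWin (view (dd tm) c) ka.1).length
  · rw [dif_pos h, dif_pos h]
    by_cases h2 : toSym tm ka.1 ((newWin (view (dd tm) c) ka.1)[j]) = ka.2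
    · rw [if_pos h2, decide_eq_true h2]
      simp [ClOp.target, ClOp.guard, hw.delta]
    · rw [if_neg h2, decide_eq_false h2]
      simp
  · rw [dif_neg h, dif_neg h]
    simp only [clToggle_cons, clToggle_nil, ClOp.target, ClOp.guard, hw.delta, decide_true,
      Bool.true_and, Bool.xor_false]
    rw [hw.cell _ (sub_len_lt hj _ _) ka]

open Classical in
/-- The cell part of a step toggles the code of the new cell contents. [folklore] -/
theorem clToggle_cells_part_cell {n t j : ℕ} (hj : j < Sn tm e n) (ka : KA tm) (c : tm.Cfg)
    (hc : TM2Sim.Good tm c) (w' : ℕ → Bool) (hw : Mid e n t c w') :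
    clToggle ((List.range (Sn tm e n)).flatMap (cellOps tm e n t)) w' (cellW tm e n (t + 1) j ka) =
      decide (cellVal (TM2Sim.stepTotal tm c) j ka.1 = ka.2) := by
  rw [clToggle_flatMap_of_forall_ne _ _ _ _ j List.nodup_range (List.mem_range.2 hj)]
  · rw [cellOps, clToggle_flatMap_of_forall_ne _ _ _ _ ka (nodup_kaList tm) (mem_kaList tm ka)]
    · rw [clToggle_flatMap, foldr_xor_map_of_unique (nodup_vList tm) (mem_vList tm (view (dd tm) c))]
      · exact clToggle_cellOp_self hj ka c hc w' hw
      · intro v _ hv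
        exact clToggle_cellOp_of_ne c w' hw hv _
    · intro ka' _ hne op hop
      obtain ⟨v, -, hop⟩ := List.mem_flatMap.1 hop
      rcases mem_cellOp hop with rfl | rfl <;>
        exact fun h => hne (cellW_inj tm e h).2
  · intro j' _ hne op hop
    simp only [cellOps, List.mem_flatMap] at hop
    obtain ⟨ka', -, v, -, hop⟩ := hop
    rcases mem_cellOp hop with rfl | rfl <;>
      exact fun h => hne (cellW_inj tm e h).1

open Classical in
/-- Negations of the `none` positions of a list of stacks, read at a cell position. [folklore] -/
theorem clToggle_nots_none {n t j : ℕ} (w' : ℕ → Bool) (k : tm.K) (a : Option (StackSym tm k)) :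
    ∀ (L : List tm.K), L.Nodup →
      clToggle (L.map fun k' => ClOp.not (cellW tm e n t j ⟨k', none⟩)) w'
        (cellW tm e n t j ⟨k, a⟩) = decide (k ∈ L ∧ a = none) := by
  intro L hL
  induction L with
  | nil => simp
  | cons k' L ih =>
    rw [List.nodup_cons] at hL
    rw [List.map_cons, clToggle_cons, ih hL.2]
    simp only [ClOp.target, ClOp.guard, Bool.and_true, List.mem_cons]
    by_cases hk : k = k'
    · subst hk
      have hkL : k ∉ L := hL.1
      by_cases ha : a = none
      · subst ha; simp [hkL]
      · have : cellW tm e n t j (⟨k, none⟩ : KA tm) ≠ cellW tm e n t j ⟨k, a⟩ := by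
          intro h; have := (cellW_inj tm e h).2
          simp only [Sigma.mk.injEq, heq_eq_eq, true_and] at this
          exact ha this.symm
        simp [this, ha]
    · have : cellW tm e n t j (⟨k', none⟩ : KA tm) ≠ cellW tm e n t j ⟨k, a⟩ := by
        intro h; have := (cellW_inj tm e h).2
        simp only [Sigma.mk.injEq] at this
        exact hk this.1.symm
      simp [this, hk]

open Classical in
/-- The phantom part of a step sets the `none` positions of the phantom cells. [folklore] -/
theorem clToggle_phantom_part_phantom {n t j : ℕ} (hj1 : Sn tm e n ≤ j) (hj2 : j < Sn tm e n + dd tm)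
    (w' : ℕ → Bool) (ka : KA tm) :
    clToggle ((List.range' (Sn tm e n) (dd tm)).flatMap (phantomOps tm e n t)) w'
      (cellW tm e n (t + 1) j ka) = decide (ka.2 = none) := by
  have hjmem : j ∈ List.range' (Sn tm e n) (dd tm) := by
    rw [List.mem_range'_1]; omega
  rw [clToggle_flatMap_of_forall_ne _ _ _ _ j (List.nodup_range' (step := 1) (by norm_num)) hjmem]
  · obtain ⟨k, a⟩ := ka
    unfold phantomOps
    rw [clToggle_nots_none w' k a _ (nodup_kList tm)]
    simp [mem_kList]
  · intro j' _ hne op hop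
    simp only [phantomOps, List.mem_map] at hop
    obtain ⟨k, -, rfl⟩ := hop
    exact fun h => hne (cellW_inj tm e h).1

/-- Nothing beyond the new layer is toggled. [folklore] -/
theorem clToggle_restOps_of_ge {n t i : ℕ} (hi : RB tm e n (t + 1) ≤ i) (w' : ℕ → Bool) :
    clToggle (restOps tm e n t) w' i = false :=
  clToggle_eq_false_of_forall_ne _ _ fun op hop h => by
    have := (restOps_zones hop).2.1
    omega

open Classical in
/-- **One step of the simulation**: from the invariant at layer `t`, the chains and the
cell/control/phantom gadgets of step `t` establish the invariant at layer `t + 1` for the next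
configuration (Arora–Barak 2009, proof of Lemma 10.10: every Boolean gate of the tableau
circuit is computed reversibly into a fresh wire; Sipser 2012, proof of Thm. 9.30: one row of
the tableau from the previous one). [cite: AroraBarak2009, §10.3.7 Lemma 10.10] -/
theorem inv_step (n t : ℕ) (c : tm.Cfg) (hc : TM2Sim.Good tm c)
    (hlen : ∀ k, ((TM2Sim.stepTotal tm c).stk k).length ≤ Sn tm e n) (w : ℕ → Bool)
    (hw : Inv e n t c w) : Inv e n (t + 1) (TM2Sim.stepTotal tm c) (clEval (stepOps tm e n t) w) := by
  have hmid := mid_of_inv n t c w hw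
  set w' := clEval ((vList tm).flatMap (chainOps tm e n t)) w with hw'
  have hev : ∀ i, clEval (stepOps tm e n t) w i = (w' i ^^ clToggle (restOps tm e n t) w' i) := by
    intro i
    rw [stepOps, clEval_append, clEval_apply_of_disjoint _ (restOps_disjoint n t)]
  refine ⟨fun q => ?_, fun j hj ka => ?_, fun i hi => ?_⟩
  · rw [hev, hmid.fresh _ (LB_le_ctrlW n _ q), Bool.false_xor, restOps, clToggle_append,
      clToggle_append, clToggle_ctrl_part n t c w' hmid, clToggle_cells_part_ctrl,
      clToggle_phantom_part_ctrl, Bool.xor_false, Bool.xor_false,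
      ← ctrl_stepTotal (le_of_lt (depth_lt_dd tm)) hc]
  · rw [hev, hmid.fresh _ (LB_le_cellW n _ j ka), Bool.false_xor, restOps, clToggle_append,
      clToggle_append, clToggle_ctrl_part_cell, Bool.false_xor]
    by_cases hjS : j < Sn tm e n
    · rw [clToggle_cells_part_cell hjS ka c hc w' hmid, clToggle_phantom_part_cell hjS,
        Bool.xor_false]
    · rw [clToggle_cells_part_phantom (not_lt.1 hjS), Bool.false_xor,
        clToggle_phantom_part_phantom (not_lt.1 hjS) hj, cellVal_of_length_le
          ((hlen ka.1).trans (not_lt.1 hjS))]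
      rcases ka with ⟨k, a⟩
      cases a <;> simp
  · rw [hev, hmid.fresh _ ((LB_le_ctrlW n (t + 1)
      default).trans (le_of_lt ((ctrlW_lt_RB n (t + 1) default).trans_le hi))),
      clToggle_restOps_of_ge hi, Bool.xor_false]

end Step


/-! ### Semantics: input layer, read-out, the whole run -/

section Run

variable {e : ℕ} (M : TM2ComputableAux Bool Bool)

/-- The initial wire assignment: the input on the first `n` wires, all ancillas `0`. [folklore] -/
def W₀ (n : ℕ) (x : Fin n → Bool) : ℕ → Bool := fun i => if h : i < n then x ⟨i, h⟩ else false

/-- The input word of the machine. [folklore] -/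
def inputWord (n : ℕ) (x : Fin n → Bool) : List (M.tm.Γ M.tm.k₀) :=
  (List.ofFn x).map M.inputAlphabet.symm

/-- The configuration after `t` total steps. [folklore] -/
noncomputable def cfgAt (n : ℕ) (x : Fin n → Bool) (t : ℕ) : M.tm.Cfg :=
  (TM2Sim.stepTotal M.tm)^[t] (initList M.tm (inputWord M n x))

variable {M}

/-- The input word has length `n`. [folklore] -/
theorem length_inputWord (n : ℕ) (x : Fin n → Bool) : (inputWord M n x).length = n := by
  simp [inputWord]

/-- All configurations of the run are good. [folklore] -/
theorem good_cfgAt (n : ℕ) (x : Fin n → Bool) (t : ℕ) : TM2Sim.Good M.tm (cfgAt M n x t) :=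
  TM2Sim.Good.iterate _ (TM2Sim.good_initList _ _) t

/-- Stack heights along the run (`TM2Sim.length_iterate_stepTotal_le`). [folklore] -/
theorem length_cfgAt_le (n : ℕ) (x : Fin n → Bool) (t : ℕ) (k : M.tm.K) :
    ((cfgAt M n x t).stk k).length ≤ n + TM2Sim.depth M.tm * t := by
  refine (TM2Sim.length_iterate_stepTotal_le M.tm _ k t).trans (Nat.add_le_add_right ?_ _)
  rw [TM2Comp.initList_eq]
  dsimp only
  by_cases hk : k = M.tm.k₀
  · subst hk; simp [length_inputWord]
  · rw [Function.update_of_ne hk]; simp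

/-- Stack heights along the run fit in the capacity. [folklore] -/
theorem length_cfgAt_le_Sn (n : ℕ) (x : Fin n → Bool) {t : ℕ} (ht : t ≤ Tn e n) (k : M.tm.K) :
    ((cfgAt M n x t).stk k).length ≤ Sn M.tm e n := by
  refine (length_cfgAt_le n x t k).trans ?_
  have h1 : TM2Sim.depth M.tm * t ≤ dd M.tm * Tn e n :=
    Nat.mul_le_mul (le_of_lt (depth_lt_dd _)) ht
  simp only [Sn]; omega

/-- The run, one more step. [folklore] -/
theorem cfgAt_succ (n : ℕ) (x : Fin n → Bool) (t : ℕ) :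
    cfgAt M n x (t + 1) = TM2Sim.stepTotal M.tm (cfgAt M n x t) :=
  Function.iterate_succ_apply' _ _ _

/-- The run starts in the initial configuration. [folklore] -/
theorem cfgAt_zero (n : ℕ) (x : Fin n → Bool) : cfgAt M n x 0 = initList M.tm (inputWord M n x) := rfl

/-- The cells of the input stack of the initial configuration. [folklore] -/
theorem cellVal_initList_k₀ (n : ℕ) (x : Fin n → Bool) (j : ℕ) :
    cellVal (initList M.tm (inputWord M n x)) j M.tm.k₀ =
      if h : j < n then some (symIn M (x ⟨j, h⟩)) else none := by
  rw [TM2Comp.initList_eq]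
  simp only [cellVal, Function.update_self, inputWord]
  split_ifs with h
  · rw [List.getElem?_map, List.getElem?_ofFn]
    simp only [h, ↓reduceDIte, Option.map_some, Option.bind_some]
    exact toSym_of_isSym _ (Or.inr rfl)
  · rw [List.getElem?_eq_none (by simp; omega)]; rfl

/-- The other stacks of the initial configuration are empty. [folklore] -/
theorem cellVal_initList_ne (n : ℕ) (x : Fin n → Bool) (j : ℕ) {k : M.tm.K} (hk : k ≠ M.tm.k₀) :
    cellVal (initList M.tm (inputWord M n x)) j k = none := by
  rw [TM2Comp.initList_eq]
  simp [cellVal, Function.update_of_ne hk]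

/-- Distinct input bits have distinct codes. [folklore] -/
theorem symIn_injective : Function.Injective (symIn M) := fun b b' h => by
  have := congrArg Subtype.val h
  exact M.inputAlphabet.symm.injective this

/-! #### the input layer -/

/-- Every operation of the input layer writes into layer `0` and reads input wires only. [folklore] -/
theorem inputOps_zones {n : ℕ} {op : ClOp ℕ} (h : op ∈ inputOps e M n) :
    n ≤ op.target ∧ op.target < RB M.tm e n 0 ∧ ∀ i ∈ op.controls, i < n := by
  have hLB : n = LB M.tm e n 0 := (LB_zero _ e n).symm
  simp only [inputOps, List.mem_append, List.mem_singleton, List.mem_flatMap, List.mem_range,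
    List.mem_range'_1] at h
  rcases h with rfl | ⟨i, hi, h⟩ | ⟨i, ⟨hi1, hi2⟩, h⟩
  · exact ⟨hLB.trans_le (LB_le_ctrlW n 0 _), ctrlW_lt_RB n 0 _, by simp [ClOp.controls]⟩
  · have hi' : i < Sn M.tm e n + dd M.tm := by simp only [Sn]; omega
    simp only [inCell, List.mem_append, List.mem_cons, List.not_mem_nil, or_false, List.mem_map,
      List.mem_filter] at h
    rcases h with (rfl | rfl | rfl) | ⟨k, -, rfl⟩
    · exact ⟨hLB.trans_le (LB_le_cellW n 0 _ _), cellW_lt_RB hi' _, by simp [ClOp.controls, hi]⟩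
    · exact ⟨hLB.trans_le (LB_le_cellW n 0 _ _), cellW_lt_RB hi' _, by simp [ClOp.controls]⟩
    · exact ⟨hLB.trans_le (LB_le_cellW n 0 _ _), cellW_lt_RB hi' _, by simp [ClOp.controls, hi]⟩
    · exact ⟨hLB.trans_le (LB_le_cellW n 0 _ _), cellW_lt_RB hi' _, by simp [ClOp.controls]⟩
  · have hi' : i < Sn M.tm e n + dd M.tm := by simp only [Sn] at hi2 ⊢; omega
    simp only [emptyCell, List.mem_map] at h
    obtain ⟨k, -, rfl⟩ := h
    exact ⟨hLB.trans_le (LB_le_cellW n 0 _ _), cellW_lt_RB hi' _, by simp [ClOp.controls]⟩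

/-- No target of the input layer is a control of it. [folklore] -/
theorem inputOps_disjoint (n : ℕ) :
    ∀ op ∈ inputOps e M n, ∀ op' ∈ inputOps e M n, op'.target ∉ op.controls := by
  intro op hop op' hop' hmem
  have h1 := (inputOps_zones hop).2.2 _ hmem
  have h2 := (inputOps_zones hop').1
  omega

/-- Ancillas start at `0`. [folklore] -/
theorem W₀_of_le {n i : ℕ} (x : Fin n → Bool) (h : n ≤ i) : W₀ n x i = false := by
  simp [W₀, not_lt.2 h]

/-- Input wires hold the input. [folklore] -/
theorem W₀_of_lt {n i : ℕ} (x : Fin n → Bool) (h : i < n) : W₀ n x i = x ⟨i, h⟩ := by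
  simp [W₀, h]

open Classical in
/-- The input gadget of cell `j` toggles the code of input bit `j`. [folklore] -/
theorem clToggle_inCell_self {n j : ℕ} (hj : j < n) (x : Fin n → Bool) (ka : KA M.tm) :
    clToggle (inCell e M n j) (W₀ n x) (cellW M.tm e n 0 j ka) =
      decide (cellVal (initList M.tm (inputWord M n x)) j ka.1 = ka.2) := by
  obtain ⟨k, a⟩ := ka
  rw [inCell, clToggle_append]
  by_cases hk : k = M.tm.k₀
  · subst hk
    rw [clToggle_eq_false_of_forall_ne ((List.filter _ _).map _) _ (fun op hop => ?_), Bool.xor_false,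
      cellVal_initList_k₀, dif_pos hj]
    · have hTF : cellW M.tm e n 0 j (⟨M.tm.k₀, some (symIn M true)⟩ : KA M.tm) ≠
          cellW M.tm e n 0 j ⟨M.tm.k₀, some (symIn M false)⟩ := fun h => by
        have := (cellW_inj M.tm e h).2
        simp only [Sigma.mk.injEq, heq_eq_eq, true_and, Option.some.injEq] at this
        exact absurd (symIn_injective this) (by decide)
      simp only [clToggle_cons, clToggle_nil, ClOp.target, ClOp.guard, W₀_of_lt x hj,
        Bool.xor_false, Bool.and_true]
      by_cases haT : a = some (symIn M true)
      · subst haT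
        simp only [decide_true, Bool.true_and, Ne.symm hTF, decide_false, Bool.false_and,
          Bool.xor_false, Option.some.injEq]
        cases hx : x ⟨j, hj⟩
        · rw [decide_eq_false (fun h => absurd (symIn_injective h) (by decide))]
        · simp
      · by_cases haF : a = some (symIn M false)
        · subst haF
          simp only [hTF, decide_false, Bool.false_and, decide_true, Bool.true_and, Bool.false_xor,
            Option.some.injEq]
          cases hx : x ⟨j, hj⟩
          · simp
          · rw [decide_eq_false (fun h => absurd (symIn_injective h) (by decide))]; rfl
        · have h1 : cellW M.tm e n 0 j (⟨M.tm.k₀, some (symIn M true)⟩ : KA M.tm) ≠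
              cellW M.tm e n 0 j ⟨M.tm.k₀, a⟩ := fun h => by
            have := (cellW_inj M.tm e h).2
            simp only [Sigma.mk.injEq, heq_eq_eq, true_and] at this; exact haT this.symm
          have h2 : cellW M.tm e n 0 j (⟨M.tm.k₀, some (symIn M false)⟩ : KA M.tm) ≠
              cellW M.tm e n 0 j ⟨M.tm.k₀, a⟩ := fun h => by
            have := (cellW_inj M.tm e h).2
            simp only [Sigma.mk.injEq, heq_eq_eq, true_and] at this; exact haF this.symm
          simp only [h1, h2, decide_false, Bool.false_and, Bool.false_xor]
          rw [decide_eq_false]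
          intro h
          cases hx : x ⟨j, hj⟩ <;> rw [hx] at h
          · exact haF h.symm
          · exact haT h.symm
    · simp only [List.mem_map, List.mem_filter] at hop
      obtain ⟨k', ⟨-, hk'⟩, rfl⟩ := hop
      intro h
      have := (cellW_inj M.tm e h).2
      simp only [Sigma.mk.injEq] at this
      have hk'' : k' ≠ M.tm.k₀ := by simpa using hk'
      exact hk'' this.1
  · rw [clToggle_eq_false_of_forall_ne [_, _, _] _ (fun op hop => ?_), Bool.false_xor,
      clToggle_nots_none (W₀ n x) k a _ ((nodup_kList M.tm).filter _), cellVal_initList_ne _ _ _ hk]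
    · simp [mem_kList, hk, eq_comm]
    · simp only [List.mem_cons, List.not_mem_nil, or_false] at hop
      rcases hop with rfl | rfl | rfl <;>
      · intro h
        have := (cellW_inj M.tm e h).2
        simp only [Sigma.mk.injEq] at this
        exact hk this.1.symm

open Classical in
/-- **The input layer establishes the invariant** at layer `0` for the initial configuration
(the first row of the tableau is the start configuration on the input; Sipser 2012, proof of
Thm. 9.30). [cite: Sipser2012, Thm. 9.30 (proof)] -/
theorem inv_input (n : ℕ) (x : Fin n → Bool) :
    Inv e n 0 (cfgAt M n x 0) (clEval (inputOps e M n) (W₀ n x)) := by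
  have hev : ∀ i, clEval (inputOps e M n) (W₀ n x) i =
      (W₀ n x i ^^ clToggle (inputOps e M n) (W₀ n x) i) := fun i =>
    clEval_apply_of_disjoint _ (inputOps_disjoint n) _ i
  have hLB : n = LB M.tm e n 0 := (LB_zero _ e n).symm
  rw [cfgAt_zero]
  refine ⟨fun q => ?_, fun j hj ka => ?_, fun i hi => ?_⟩
  · rw [hev, W₀_of_le x (hLB.trans_le (LB_le_ctrlW n 0 q)), Bool.false_xor, inputOps, clToggle_append,
      clToggle_append, clToggle_flatMap_eq_false (List.range n), clToggle_flatMap_eq_false,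
      Bool.xor_false, Bool.xor_false, TM2Comp.initList_eq]
    · simp only [clToggle_cons, clToggle_nil, ClOp.target, ClOp.guard, Bool.and_true,
        Bool.xor_false]
      by_cases hq : (some M.tm.main, M.tm.initialState) = q
      · subst hq; simp
      · have : ctrlW M.tm e n 0 (some M.tm.main, M.tm.initialState) ≠ ctrlW M.tm e n 0 q :=
          fun h => hq (ctrlW_inj M.tm e h)
        simp [this, hq]
    · intro i _ op hop
      simp only [emptyCell, List.mem_map] at hop
      obtain ⟨k, -, rfl⟩ := hop
      exact (ctrlW_lt_cellW n 0 q i _).ne'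
    · intro i _ op hop
      simp only [inCell, List.mem_append, List.mem_cons, List.not_mem_nil, or_false, List.mem_map,
        List.mem_filter] at hop
      rcases hop with (rfl | rfl | rfl) | ⟨k, -, rfl⟩ <;> exact (ctrlW_lt_cellW n 0 q i _).ne'
  · rw [hev, W₀_of_le x (hLB.trans_le (LB_le_cellW n 0 j ka)), Bool.false_xor, inputOps,
      clToggle_append, clToggle_append]
    rw [show clToggle [ClOp.not (ctrlW M.tm e n 0 (some M.tm.main, M.tm.initialState))] (W₀ n x)
        (cellW M.tm e n 0 j ka) = false by
      simp [ClOp.target, (ctrlW_lt_cellW n 0 _ j ka).ne], Bool.false_xor]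
    by_cases hjn : j < n
    · rw [clToggle_flatMap_of_forall_ne _ _ _ _ j List.nodup_range (List.mem_range.2 hjn),
        clToggle_flatMap_eq_false, Bool.xor_false, clToggle_inCell_self hjn]
      · intro i hi op hop h
        simp only [emptyCell, List.mem_map] at hop
        obtain ⟨k, -, rfl⟩ := hop
        have := (cellW_inj M.tm e h).1
        rw [List.mem_range'_1] at hi
        omega
      · intro i _ hne op hop
        simp only [inCell, List.mem_append, List.mem_cons, List.not_mem_nil, or_false, List.mem_map,
          List.mem_filter] at hop
        rcases hop with (rfl | rfl | rfl) | ⟨k, -, rfl⟩ <;> exact fun h => hne (cellW_inj M.tm e h).1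
    · rw [clToggle_flatMap_eq_false, Bool.false_xor,
        clToggle_flatMap_of_forall_ne _ _ _ _ j (List.nodup_range' (step := 1) (by norm_num))
          (by rw [List.mem_range'_1]; omega)]
      · obtain ⟨k, a⟩ := ka
        rw [emptyCell, clToggle_nots_none (W₀ n x) k a _ (nodup_kList M.tm)]
        by_cases hk : k = M.tm.k₀
        · subst hk
          rw [cellVal_initList_k₀, dif_neg hjn]
          simp [mem_kList, eq_comm]
        · rw [cellVal_initList_ne _ _ _ hk]
          simp [mem_kList, eq_comm]
      · intro i _ hne op hop
        simp only [emptyCell, List.mem_map] at hop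
        obtain ⟨k, -, rfl⟩ := hop
        exact fun h => hne (cellW_inj M.tm e h).1
      · intro i hi op hop h
        simp only [inCell, List.mem_append, List.mem_cons, List.not_mem_nil, or_false, List.mem_map,
          List.mem_filter] at hop
        rw [List.mem_range] at hi
        rcases hop with (rfl | rfl | rfl) | ⟨k, -, rfl⟩ <;>
        · have := (cellW_inj M.tm e h).1; omega
  · rw [hev, W₀_of_le x (le_of_lt ((inputOps_zones (e := e) (M := M) (n := n)
      (op := ClOp.not (ctrlW M.tm e n 0 (some M.tm.main, M.tm.initialState))) (by simp [inputOps])).1.trans_lt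
      ((ctrlW_lt_RB n 0 _).trans_le hi))),
      clToggle_eq_false_of_forall_ne _ _ (fun op hop h => ?_), Bool.xor_false]
    have := (inputOps_zones hop).2.1
    omega

/-! #### the run -/

/-- The wire assignment after the input layer and `t` steps. [folklore] -/
noncomputable def wAt (n : ℕ) (x : Fin n → Bool) : ℕ → ℕ → Bool
  | 0 => clEval (inputOps e M n) (W₀ n x)
  | t + 1 => clEval (stepOps M.tm e n t) (wAt n x t)

/-- The assignment after the input layer and `t` steps. [folklore] -/
theorem clEval_steps (n : ℕ) (x : Fin n → Bool) (t : ℕ) :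
    clEval (inputOps e M n ++ (List.range t).flatMap (stepOps M.tm e n)) (W₀ n x) =
      wAt (e := e) (M := M) n x t := by
  induction t with
  | zero => simp [wAt]
  | succ t ih =>
    rw [List.range_succ, List.flatMap_append, ← List.append_assoc, clEval_append, ih]
    simp [wAt]

open Classical in
/-- The invariant holds along the run. [folklore] -/
theorem inv_wAt (n : ℕ) (x : Fin n → Bool) :
    ∀ t ≤ Tn e n, Inv e n t (cfgAt M n x t) (wAt (e := e) (M := M) n x t)
  | 0, _ => inv_input n x
  | t + 1, ht => by
    rw [cfgAt_succ]
    exact inv_step n t _ (good_cfgAt n x t) (fun k => by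
      rw [← cfgAt_succ]; exact length_cfgAt_le_Sn n x ht k) _ (inv_wAt n x t (Nat.le_of_succ_le ht))

/-- The answer wire is not wire `0`. [folklore] -/
theorem ansW_pos (n : ℕ) : 0 < ansW M.tm e n := by
  have := one_le_nC M.tm
  simp only [ansW, LW]; omega

open Classical in
/-- **Read-out.** After the run, the output gadget leaves on wire `0` the bit
`[cell 0 of the output stack holds the code of true]`. [folklore] -/
theorem clEval_outputOps_zero (n : ℕ) (c : M.tm.Cfg) (w : ℕ → Bool) (hw : Inv e n (Tn e n) c w) :
    clEval (outputOps e M n) w 0 =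
      decide (cellVal c 0 M.tm.k₁ = toSym M.tm M.tm.k₁ (M.outputAlphabet.symm true)) := by
  rw [outputOps, clEval_cons, clEval_swap_apply _ _ (ansW_pos n).ne', ClOp.eval_cnot,
    Function.update_self, hw.fresh (ansW M.tm e n) le_rfl, Bool.false_xor,
    hw.cell 0 (by have := one_le_dd M.tm; omega) (outKA M)]
  rfl

open Classical in
/-- **The whole program over `ℕ`-indexed wires**: if `M` halts on `x` with output word `[b]`
within `T(n)` steps, then running the reversible program on the input `x` followed by zeros
leaves `b` on wire `0` (the reversible machine "producing `x; M(x)`" of Bernstein–Vazirani's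
Thm. 8.2, in circuit form). [cite: BernsteinVazirani1997, Thm. 8.2 (proof)] -/
theorem clEval_allOps_zero (n : ℕ) (x : Fin n → Bool) (b : Bool)
    (hM : M.OutputsWithin (List.ofFn x) [b] (Tn e n)) :
    clEval (allOps e M n) (W₀ n x) 0 = b := by
  rw [allOps, ← List.append_assoc, clEval_append, clEval_steps,
    clEval_outputOps_zero n _ _ (inv_wAt n x _ le_rfl)]
  have hT : cfgAt M n x (Tn e n) = haltList M.tm [M.outputAlphabet.symm b] :=
    TM2Sim.iterate_stepTotal_of_outputsWithin M hM
  have hgood := good_cfgAt (M := M) n x (Tn e n)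
  rw [hT] at hgood ⊢
  rw [TM2Comp.haltList_eq] at hgood ⊢
  have hsym : TM2Sim.IsSym M.tm M.tm.k₁ (M.outputAlphabet.symm b) := hgood M.tm.k₁ _ (by simp)
  have hval : cellVal (⟨none, M.tm.initialState, Function.update (fun _ => []) M.tm.k₁
      [M.outputAlphabet.symm b]⟩ : M.tm.Cfg) 0 M.tm.k₁ = some ⟨_, hsym⟩ := by
    simp [cellVal, toSym_of_isSym _ hsym]
  rw [hval]
  cases b
  · rw [decide_eq_false]
    intro h
    by_cases ht : TM2Sim.IsSym M.tm M.tm.k₁ (M.outputAlphabet.symm true)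
    · rw [toSym_of_isSym _ ht, Option.some.injEq] at h
      have h' := congrArg (symVal M.tm M.tm.k₁) h
      simp only [symVal_mk] at h'
      exact absurd (M.outputAlphabet.symm.injective h') (by decide)
    · rw [toSym] at h
      simp only [ht, ↓reduceDIte] at h
      exact Option.some_ne_none _ h
  · rw [toSym_of_isSym _ hsym, decide_eq_true rfl]

end Run


/-! ### From `ℕ`-indexed wires to `Fin N`, and the circuit family -/

section Transport

/-- All wires of an operation. [folklore] -/
def wiresOf {ι : Type*} (op : ClOp ι) : List ι := op.target :: op.controls

/-- Membership in the wires of an operation. [folklore] -/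
@[simp] theorem mem_wiresOf {ι : Type*} (op : ClOp ι) (i : ι) :
    i ∈ wiresOf op ↔ i = op.target ∨ i ∈ op.controls := by simp [wiresOf]

/-- Reduction of an index modulo `N` (the identity below `N`). [folklore] -/
def finOf (N : ℕ) (h : 0 < N) (i : ℕ) : Fin N := ⟨i % N, Nat.mod_lt i h⟩

/-- `finOf` is the identity below `N`. [folklore] -/
theorem finOf_of_lt {N i : ℕ} (h : 0 < N) (hi : i < N) : finOf N h i = ⟨i, hi⟩ :=
  Fin.ext (Nat.mod_eq_of_lt hi)

/-- `finOf` is the identity below `N` (values). [folklore] -/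
theorem val_finOf_of_lt {N i : ℕ} (h : 0 < N) (hi : i < N) : (finOf N h i : ℕ) = i :=
  Nat.mod_eq_of_lt hi

/-- Extension of an assignment of `Fin N` to `ℕ` by `0`. [folklore] -/
def liftW {N : ℕ} (w : Fin N → Bool) : ℕ → Bool := fun i => if h : i < N then w ⟨i, h⟩ else false

/-- The extension agrees with the assignment on `Fin N`. [folklore] -/
theorem liftW_val {N : ℕ} (w : Fin N → Bool) (p : Fin N) : liftW w p = w p := by
  simp [liftW, p.isLt]

/-- Reading through `finOf` below `N`. [folklore] -/
theorem liftW_comp_finOf {N : ℕ} (h : 0 < N) (w : Fin N → Bool) {i : ℕ} (hi : i < N) :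
    (w ∘ finOf N h) i = liftW w i := by
  simp [finOf_of_lt h hi, liftW, hi]

/-- One re-indexed operation acts as the original on the extension. [folklore] -/
theorem liftW_eval_map {N : ℕ} (h : 0 < N) (op : ClOp ℕ) (hop : ∀ i ∈ wiresOf op, i < N)
    (w : Fin N → Bool) : liftW ((op.map (finOf N h)).eval w) = op.eval (liftW w) := by
  have ht : op.target < N := hop _ (by simp)
  have hg : (op.map (finOf N h)).guard w = op.guard (liftW w) := by
    rw [ClOp.guard_map]
    exact ClOp.guard_congr op fun c hc => liftW_comp_finOf h w (hop c (by simp [hc]))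
  funext i
  by_cases hi : i < N
  · have e1 : liftW ((op.map (finOf N h)).eval w) i = (op.map (finOf N h)).eval w ⟨i, hi⟩ := by
      simp [liftW, hi]
    rw [e1, ClOp.eval_apply, ClOp.eval_apply, hg, ClOp.target_map, finOf_of_lt h ht]
    simp only [liftW, hi, ↓reduceDIte, Fin.ext_iff]
  · have hne : i ≠ op.target := fun heq => hi (heq ▸ ht)
    rw [ClOp.eval_apply_of_ne _ _ hne]
    simp [liftW, hi]

/-- A re-indexed program acts as the original on the extension. [folklore] -/
theorem liftW_clEval_map {N : ℕ} (h : 0 < N) :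
    ∀ (ops : List (ClOp ℕ)), (∀ op ∈ ops, ∀ i ∈ wiresOf op, i < N) → ∀ (w : Fin N → Bool),
      liftW (clEval (ops.map (ClOp.map (finOf N h))) w) = clEval ops (liftW w)
  | [], _, w => rfl
  | op :: ops, hops, w => by
    rw [List.map_cons, clEval_cons, clEval_cons,
      liftW_clEval_map h ops (fun o ho => hops o (by simp [ho])), liftW_eval_map h op (hops op (by simp))]

/-- A re-indexed program acts as the original, pointwise. [folklore] -/
theorem clEval_map_finOf_apply {N : ℕ} (h : 0 < N) (ops : List (ClOp ℕ))
    (hops : ∀ op ∈ ops, ∀ i ∈ wiresOf op, i < N) (w : Fin N → Bool) (p : Fin N) :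
    clEval (ops.map (ClOp.map (finOf N h))) w p = clEval ops (liftW w) p := by
  rw [← liftW_val (clEval _ w) p, liftW_clEval_map h ops hops w]

/-- Re-indexing below `N` preserves well-formedness. [folklore] -/
theorem wf_map_finOf {N : ℕ} (h : 0 < N) {op : ClOp ℕ} (hop : ∀ i ∈ wiresOf op, i < N)
    (hwf : op.WF) : (op.map (finOf N h)).WF := by
  cases op with
  | not i => trivial
  | cnot i j =>
    simp only [mem_wiresOf, ClOp.target, ClOp.controls, List.mem_cons, List.not_mem_nil,
      or_false, forall_eq_or_imp, forall_eq] at hop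
    intro heq
    have := congrArg Fin.val heq
    rw [val_finOf_of_lt h hop.2, val_finOf_of_lt h hop.1] at this
    exact hwf this
  | toffoli a b c =>
    simp only [mem_wiresOf, ClOp.target, ClOp.controls, List.mem_cons, List.not_mem_nil,
      or_false, forall_eq_or_imp, forall_eq] at hop
    obtain ⟨hc, ha, hb⟩ := hop
    obtain ⟨h1, h2, h3⟩ := hwf
    refine ⟨fun heq => h1 ?_, fun heq => h2 ?_, fun heq => h3 ?_⟩ <;>
    · have := congrArg Fin.val heq
      rwa [val_finOf_of_lt h (by assumption), val_finOf_of_lt h (by assumption)] at this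

end Transport

/-! ### Well-formedness and wire bounds of the program -/

section Bounds

variable {e : ℕ} {M : TM2ComputableAux Bool Bool}

/-- Control wires are not ancillas. [folklore] -/
theorem ctrlW_ne_ancW (n t t' : ℕ) (q : Ctrl tm) (v : V tm) {m : ℕ} (hm : m < rr tm) :
    ctrlW tm e n t q ≠ ancW tm e n t' v m := by
  rw [ctrlW_eq, ancW_eq]
  intro h
  have := (inPeriod_inj tm e ((ctrl_off_lt tm q).trans_le ((nC_le_LW tm e n).trans
    (LW_lt_PP tm e n).le)) (anc_off_lt tm e v hm) h).2
  have h2 := ctrl_off_lt tm q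
  have h3 := nC_le_LW tm e n
  omega

/-- Cell wires are not ancillas. [folklore] -/
theorem cellW_ne_ancW {n t t' j : ℕ} (hj : j < Sn tm e n + dd tm) (ka : KA tm) (v : V tm) {m : ℕ}
    (hm : m < rr tm) : cellW tm e n t j ka ≠ ancW tm e n t' v m := by
  rw [cellW_eq, ancW_eq]
  intro h
  have := (inPeriod_inj tm e ((cell_off_lt tm e hj ka).trans (LW_lt_PP tm e n))
    (anc_off_lt tm e v hm) h).2
  have h2 := cell_off_lt tm e hj ka
  omega

/-- Control wires are not cell wires. [folklore] -/
theorem ctrlW_ne_cellW (n t t' : ℕ) (q : Ctrl tm) (j : ℕ) (ka : KA tm)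
    (hj : j < Sn tm e n + dd tm) : ctrlW tm e n t q ≠ cellW tm e n t' j ka := by
  rw [ctrlW_eq, cellW_eq]
  intro h
  have := (inPeriod_inj tm e ((ctrl_off_lt tm q).trans_le ((nC_le_LW tm e n).trans
    (LW_lt_PP tm e n).le)) ((cell_off_lt tm e hj ka).trans (LW_lt_PP tm e n)) h).2
  have h2 := ctrl_off_lt tm q
  omega

/-- The index of the decision wire. [folklore] -/
theorem rr_sub_one_lt : rr tm - 1 < rr tm := by have := one_le_rr tm; omega

/-- Chains are well formed. [folklore] -/
theorem chainOps_wf {n t : ℕ} (v : V tm) : ∀ op ∈ chainOps tm e n t v, op.WF := fun op hop =>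
  wf_of_mem_clChain (nodup_ancs n t v) (fun h => by
      obtain ⟨m, hm, hmeq⟩ := mem_ancs_iff.1 h
      exact ctrlW_ne_ancW n t t v.1 v hm hmeq)
    (fun l hl => by
      obtain ⟨m, k, rfl⟩ := mem_lits_iff.1 hl
      have hm : (m : ℕ) < Sn tm e n + dd tm := by have := m.isLt; omega
      exact ⟨fun h => by
        obtain ⟨m', hm', hmeq⟩ := mem_ancs_iff.1 h
        exact cellW_ne_ancW hm _ v hm' hmeq, (ctrlW_ne_cellW n t t v.1 _ _ hm).symm⟩)
    hop

/-- The rest of a step is well formed. [folklore] -/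
theorem restOps_wf {n t : ℕ} : ∀ op ∈ restOps tm e n t, op.WF := by
  intro op hop
  have hz := restOps_zones hop
  simp only [restOps, List.mem_append] at hop
  rcases hop with h | h | h
  · obtain ⟨v, rfl⟩ := mem_ctrlOps_flatMap h
    exact (deltaW_lt_LB_succ n t v).trans_le (LB_le_ctrlW n _ _) |>.ne
  · obtain ⟨j, hj, ka, v, h⟩ := mem_cellOps_flatMap h
    rcases mem_cellOp h with rfl | rfl
    · exact (deltaW_lt_LB_succ n t v).trans_le (LB_le_cellW n _ _ _) |>.ne
    · refine ⟨?_, (deltaW_lt_LB_succ n t v).trans_le (LB_le_cellW n _ _ _) |>.ne, ?_⟩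
      · exact (cellW_ne_ancW (sub_len_lt hj v ka.1) ka v rr_sub_one_lt).symm
      · exact ((cellW_lt_RB (sub_len_lt hj v ka.1) ka).trans_le
          ((RB_le_LB_succ n t).trans (LB_le_cellW n _ _ _))).ne
  · obtain ⟨j, -, -, k, rfl⟩ := mem_phantomOps_flatMap h
    trivial

/-- Steps are well formed. [folklore] -/
theorem stepOps_wf {n t : ℕ} : ∀ op ∈ stepOps tm e n t, op.WF := by
  intro op hop
  simp only [stepOps, List.mem_append, List.mem_flatMap] at hop
  rcases hop with ⟨v, -, h⟩ | h
  · exact chainOps_wf v op h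
  · exact restOps_wf op h

/-- The input layer consists of negations and `CNOT`s. [folklore] -/
theorem inputOps_shape {n : ℕ} {op : ClOp ℕ} (hop : op ∈ inputOps e M n) :
    (∃ w, op = ClOp.not w) ∨ ∃ i w, op = ClOp.cnot i w := by
  simp only [inputOps, List.mem_append, List.mem_singleton, List.mem_flatMap] at hop
  rcases hop with rfl | ⟨i, -, h⟩ | ⟨i, -, h⟩
  · exact Or.inl ⟨_, rfl⟩
  · simp only [inCell, List.mem_append, List.mem_cons, List.not_mem_nil, or_false, List.mem_map,
      List.mem_filter] at h
    rcases h with (rfl | rfl | rfl) | ⟨k, -, rfl⟩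
    · exact Or.inr ⟨_, _, rfl⟩
    · exact Or.inl ⟨_, rfl⟩
    · exact Or.inr ⟨_, _, rfl⟩
    · exact Or.inl ⟨_, rfl⟩
  · simp only [emptyCell, List.mem_map] at h
    obtain ⟨k, -, rfl⟩ := h
    exact Or.inl ⟨_, rfl⟩

/-- The input layer is well formed. [folklore] -/
theorem inputOps_wf {n : ℕ} : ∀ op ∈ inputOps e M n, op.WF := by
  intro op hop
  have hz := inputOps_zones hop
  rcases inputOps_shape hop with ⟨w, rfl⟩ | ⟨i, w, rfl⟩
  · trivial
  · have h1 : i < n := hz.2.2 i (by simp [ClOp.controls])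
    have h2 : n ≤ w := hz.1
    exact Nat.ne_of_lt (h1.trans_le h2)

/-- The output gadget is well formed. [folklore] -/
theorem outputOps_wf {n : ℕ} : ∀ op ∈ outputOps e M n, op.WF := by
  intro op hop
  have h0 : (0 : ℕ) ≠ ansW M.tm e n := (ansW_pos (e := e) (M := M) n).ne
  simp only [outputOps, List.mem_cons, List.not_mem_nil, or_false] at hop
  rcases hop with rfl | rfl | rfl | rfl
  · exact (cellW_lt_RB (tm := M.tm) (e := e) (n := n) (t := Tn e n) (j := 0)
      (by have := one_le_dd M.tm; omega) (outKA M)).ne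
  · exact h0.symm
  · exact h0
  · exact h0.symm

/-- The whole program is well formed. [folklore] -/
theorem allOps_wf {n : ℕ} : ∀ op ∈ allOps e M n, op.WF := by
  intro op hop
  simp only [allOps, List.mem_append, List.mem_flatMap] at hop
  rcases hop with h | ⟨t, -, h⟩ | h
  · exact inputOps_wf op h
  · exact stepOps_wf op h
  · exact outputOps_wf op h

/-! #### wire bounds -/

/-- Regions of the run lie before the answer wire. [folklore] -/
theorem RB_le_ansW {n t : ℕ} (ht : t ≤ Tn e n) : RB tm e n t ≤ ansW tm e n := by
  simp only [RB, ansW]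
  exact Nat.add_le_add_right (LB_mono n ht) _

/-- Layers of the run lie before the answer wire. [folklore] -/
theorem LB_succ_le_ansW {n t : ℕ} (ht : t < Tn e n) : LB tm e n (t + 1) ≤ ansW tm e n :=
  (LB_mono n (Nat.succ_le_of_lt ht)).trans (Nat.le_add_right _ _)

/-- Chains use wires before the next layer. [folklore] -/
theorem chainOps_lt {n t : ℕ} (v : V tm) :
    ∀ op ∈ chainOps tm e n t v, ∀ i ∈ wiresOf op, i < LB tm e n (t + 1) := by
  intro op hop i hi
  unfold chainOps at hop
  -- every link of the chain is `toffoli seed/ancilla literal ancilla`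
  have key : ∀ (a₀ : ℕ) (ls as : List ℕ), a₀ < LB tm e n (t + 1) → (∀ l ∈ ls, l < LB tm e n (t + 1)) →
      (∀ a ∈ as, a < LB tm e n (t + 1)) → ∀ op ∈ clChain a₀ ls as, ∀ i ∈ wiresOf op,
        i < LB tm e n (t + 1) := by
    intro a₀ ls as h0 hls has
    induction ls generalizing a₀ as with
    | nil => simp
    | cons l ls ih =>
      cases as with
      | nil => simp
      | cons a as =>
        intro op hop i hi
        rw [clChain_cons_cons, List.mem_cons] at hop
        rcases hop with rfl | hop
        · simp only [mem_wiresOf, ClOp.target, ClOp.controls, List.mem_cons, List.not_mem_nil,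
            or_false] at hi
          rcases hi with rfl | rfl | rfl
          · exact has _ (by simp)
          · exact h0
          · exact hls _ (by simp)
        · exact ih a as (has _ (by simp)) (fun l' hl' => hls l' (by simp [hl']))
            (fun a' ha' => has a' (by simp [ha'])) op hop i hi
  refine key _ _ _ ((ctrlW_lt_RB n t v.1).trans_le (RB_le_LB_succ n t))
    (fun l hl => (lits_lt_RB hl).trans_le (RB_le_LB_succ n t))
    (fun a ha => ?_) op hop i hi
  obtain ⟨m, hm, rfl⟩ := mem_ancs_iff.1 ha
  exact ancW_lt_LB_succ v hm

/-- Steps use wires of the circuit. [folklore] -/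
theorem stepOps_lt {n t : ℕ} (ht : t < Tn e n) :
    ∀ op ∈ stepOps tm e n t, ∀ i ∈ wiresOf op, i < ansW tm e n + 1 := by
  intro op hop i hi
  simp only [stepOps, List.mem_append, List.mem_flatMap] at hop
  rcases hop with ⟨v, -, h⟩ | h
  · exact ((chainOps_lt v op h i hi).trans_le (LB_succ_le_ansW ht)).trans (Nat.lt_succ_self _)
  · have hz := restOps_zones h
    simp only [mem_wiresOf] at hi
    rcases hi with rfl | hi
    · exact (hz.2.1.trans_le (RB_le_ansW (Nat.succ_le_of_lt ht))).trans (Nat.lt_succ_self _)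
    · exact ((hz.2.2 i hi).trans_le (LB_succ_le_ansW ht)).trans (Nat.lt_succ_self _)

/-- The input layer uses wires of the circuit. [folklore] -/
theorem inputOps_lt {n : ℕ} : ∀ op ∈ inputOps e M n, ∀ i ∈ wiresOf op, i < ansW M.tm e n + 1 := by
  intro op hop i hi
  have hz := inputOps_zones hop
  have h0 : RB M.tm e n 0 ≤ ansW M.tm e n := RB_le_ansW (Nat.zero_le _)
  simp only [mem_wiresOf] at hi
  rcases hi with rfl | hi
  · exact (hz.2.1.trans_le h0).trans (Nat.lt_succ_self _)
  · have := hz.2.2 i hi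
    have h1 := hz.1
    have h2 := hz.2.1
    omega

/-- The output gadget uses wires of the circuit. [folklore] -/
theorem outputOps_lt {n : ℕ} : ∀ op ∈ outputOps e M n, ∀ i ∈ wiresOf op, i < ansW M.tm e n + 1 := by
  intro op hop i hi
  have hsrc : cellW M.tm e n (Tn e n) 0 (outKA M) < ansW M.tm e n + 1 :=
    ((cellW_lt_RB (tm := M.tm) (e := e) (n := n) (t := Tn e n) (j := 0)
      (by have := one_le_dd M.tm; omega) (outKA M)).trans_le (RB_le_ansW le_rfl)).trans
      (Nat.lt_succ_self _)
  have hans : ansW M.tm e n < ansW M.tm e n + 1 := Nat.lt_succ_self _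
  have h0 : 0 < ansW M.tm e n + 1 := Nat.succ_pos _
  simp only [outputOps, List.mem_cons, List.not_mem_nil, or_false] at hop
  rcases hop with rfl | rfl | rfl | rfl <;>
    simp only [mem_wiresOf, ClOp.target, ClOp.controls, List.mem_cons, List.not_mem_nil,
      or_false] at hi <;> rcases hi with rfl | rfl <;> assumption

/-- The whole program uses wires of the circuit only. [folklore] -/
theorem allOps_lt {n : ℕ} : ∀ op ∈ allOps e M n, ∀ i ∈ wiresOf op, i < ansW M.tm e n + 1 := by
  intro op hop
  simp only [allOps, List.mem_append, List.mem_flatMap, List.mem_range] at hop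
  rcases hop with h | ⟨t, ht, h⟩ | h
  · exact inputOps_lt op h
  · exact stepOps_lt ht op h
  · exact outputOps_lt op h

end Bounds

/-! ### The circuit family -/

section Family

variable (e : ℕ) (M : TM2ComputableAux Bool Bool)

/-- The total number of wires, `n + ancN`. [folklore] -/
noncomputable abbrev NN (n : ℕ) : ℕ := n + ancN M.tm e n

/-- The number of wires is the answer wire plus one. [folklore] -/
theorem NN_eq (n : ℕ) : NN e M n = ansW M.tm e n + 1 := by
  simp only [NN, ansW, ancN, LB]; ring

/-- There is a wire. [folklore] -/
theorem NN_pos (n : ℕ) : 0 < NN e M n := by rw [NN_eq]; exact Nat.succ_pos _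

/-- The program on `Fin (n + ancN)` wires. [folklore] -/
noncomputable def opsFin (n : ℕ) : List (ClOp (Fin (NN e M n))) :=
  (allOps e M n).map (ClOp.map (finOf (NN e M n) (NN_pos e M n)))

/-- The whole program uses wires below `NN`. [folklore] -/
theorem allOps_lt_NN {n : ℕ} : ∀ op ∈ allOps e M n, ∀ i ∈ wiresOf op, i < NN e M n := by
  rw [NN_eq]; exact allOps_lt

/-- The re-indexed program is well formed. [folklore] -/
theorem opsFin_wf (n : ℕ) : ∀ op ∈ opsFin e M n, op.WF := by
  intro op hop
  simp only [opsFin, List.mem_map] at hop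
  obtain ⟨op, hop, rfl⟩ := hop
  exact wf_map_finOf _ (allOps_lt_NN e M op hop) (allOps_wf op hop)

/-- **The reversible program** simulating `M` for `T(n) = (n+2)^e` steps on inputs of length
`n`, as a list of `NOT`/`CNOT`/Toffoli operations on `n + ancN` wires (`ReversibleCliffordT.RevOp`).
[cite: AroraBarak2009, §10.3.7 Lemma 10.10] -/
noncomputable def revProg (n : ℕ) : List (RevOp (NN e M n)) :=
  toRevList (opsFin e M n) (opsFin_wf e M n)

/-- **The circuit family**: the exact Clifford+T compilation (`revCompile`: `X = HSSH`,
Toffoli `= H·CCZ·H`, Nielsen–Chuang 2010, Fig. 4.9) of `revProg`, with `ancN` ancillas.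
[cite: BernsteinVazirani1997, Thm. 8.2 (proof)] -/
noncomputable def revFamily : Literature.Computability.Cryptography.QCircuitFamily Literature.Computability.Cryptography.cliffordT :=
  ⟨fun n => ancN M.tm e n, fun n => ⟨revCompile (revProg e M n)⟩⟩

/-- The padded basis input, extended to `ℕ`, is the initial assignment `W₀`. [folklore] -/
theorem liftW_padInput (n : ℕ) (x : Literature.Computability.Cryptography.QReg n) :
    liftW (Literature.Computability.Cryptography.padInput x (ancN M.tm e n)) = W₀ n x := by
  funext i
  simp only [liftW, W₀, Literature.Computability.Cryptography.padInput]
  by_cases hi : i < n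
  · have hi' : i < n + ancN M.tm e n := by omega
    rw [dif_pos hi', dif_pos hi]
    exact Fin.append_left x _ ⟨i, hi⟩
  · rw [dif_neg hi]
    by_cases hi' : i < n + ancN M.tm e n
    · rw [dif_pos hi']
      have : (⟨i, hi'⟩ : Fin (n + ancN M.tm e n)) = Fin.natAdd n ⟨i - n, by omega⟩ := by
        ext; simp; omega
      rw [this, Fin.append_right]
    · rw [dif_neg hi']

/-- **Correctness of the reversible simulation on basis inputs**: if `M` halts on `x` with
output word `[b]` within `T(n) = (n+2)^e` steps, the classical run (`revEval`) of `revProg` on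
`x 0^{ancN}` leaves `b` on wire `0`; with `revCompile_mulVec_basisState` the compiled Clifford+T
circuit therefore maps `|x⟩|0…0⟩` to a basis state whose wire `0` is `b` (Bernstein–Vazirani
1997, proof of Thm. 8.2; Arora–Barak 2009, Lemma 10.10). [cite: BernsteinVazirani1997, Thm. 8.2 (proof)] -/
theorem revEval_revProg_zero (n : ℕ) (x : Literature.Computability.Cryptography.QReg n) (b : Bool)
    (hM : M.OutputsWithin (List.ofFn x) [b] (Tn e n)) :
    revEval (revProg e M n) (Literature.Computability.Cryptography.padInput x (ancN M.tm e n)) ⟨0, NN_pos e M n⟩ = b := by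
  rw [revProg, revEval_toRevList, opsFin, clEval_map_finOf_apply _ _ (allOps_lt_NN e M),
    liftW_padInput]
  exact clEval_allOps_zero n x b hM

end Family

end RevSim

end Literature.Computability.QuantumComplexity
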